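import Mathlib.MeasureTheory.Function.LpSeminorm.CompareExp
import Mathlib.Analysis.Distribution.AEEqOfIntegralContDiff
import Literature.Analysis.FunctionSpaces.Mollification
import Literature.Analysis.FunctionSpaces.MollificationLp
import Literature.Analysis.FunctionSpaces.WeakDerivInner
import Literature.Analysis.FunctionSpaces.SobolevExtensionGlue
import Literature.Analysis.FunctionSpaces.SobolevTraceEmbeddingProofs
import Literature.Analysis.FunctionSpaces.BallLipschitzDomain
import Literature.Analysis.FluidPDE.VectorCalculus
import HarnessLib

/-!
# Velocity testing of a steady weak Euler-type identity: the two-sided local energy identity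
# for fields with `∇V ∈ L²_loc` (Sohr 2001, III.3.7; Chae–Shvydkoy 2013, §2.2)

Analysis/FluidPDE tool file (everything PROVED; no named facts).  It supplies the
"`H¹`-density / vector-mollification on `ℝ³`" infrastructure asked for by the crux lead of
route №10 `EulerZoomLiouville` (crux `PowerGaugeEulerLiouville`, rung C1: exactly self-similar
members; LEAD-REPORT v6, item (S2)): the weak (distributional) momentum identity of a
steady-type Euler system is tested against **the velocity itself times a cutoff**, which gives
the TWO-SIDED local energy identity — the lever that the local energy *inequality* does not
provide.

## Setting

`E` is a finite-dimensional real inner product space with its Lebesgue measure `volume`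
(`ℝ³ = EuclideanSpace ℝ (Fin 3)` in the application).  The data are a velocity `V : E → E` with
a whole-space weak gradient `G` (`HasWeakGradient V G`, i.e. the accepted
`FunctionSpaces.HasWeakFDerivOn ⊤ volume V G`), a pressure `P : E → ℝ` and a forcing `F : E → E`,
with, on every ball `B(0, r)`,
`V ∈ L⁶`, `G ∈ L²` (componentwise), `P ∈ L^{3/2}`, `F ∈ L²`; `V` is weakly divergence free
(`IsWeaklyDivFree V`); and the **steady weak Euler identity with forcing**
`∫ (⟪F, ψ⟫ + ⟪V, (V·∇)ψ⟫ + P div ψ) = 0` holds for every smooth compactly supported vector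
test field `ψ` — the distributional form of `(V·∇)V + ∇P = F`, `div V = 0` (the `∂ₜ`-free,
`ν = 0` case of the accepted `IsDistributionalNSSolutionOn`, with the linear self-similar terms
of a profile equation put into `F`).  In dimension three `V ∈ L⁶_loc` follows from
`V, G ∈ L²_loc` (`memLp_six_ball_of_hasWeakGradient`, the tree's Sobolev embedding on balls).

## Results

* `IsWeaklyDivFree.integral_weakGradient_apply_eq_zero` — **divergence-free testing extends to
  compactly supported `W^{1,q}` functions**: `∫ Θ(x)(V x) dx = 0` for every compactly supported
  `θ` with whole-space weak gradient `Θ ∈ L^q`, when `V ∈ L^p_loc`, `p⁻¹ + q⁻¹ = 1`,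
  `1 ≤ q < ∞` (mollify `θ`; Sohr 2001, (III.3.7.13)).  This is the general-dimension,
  general-exponent form of the tree's `IsWeaklyDivFree.integral_weakDeriv_apply_eq_zero`
  (`DivFreeSobolevTesting.lean`: `ℝ³`, `(p, q) = (3, 3/2)`, balls about `x₀`), same proof; the
  support hypothesis on `Θ` is replaced by `ae_weakGradient_eq_zero_of_not_mem_tsupport`
  (a whole-space weak gradient vanishes a.e. off `tsupport θ`).
* `IsWeaklyDivFree.trace_weakGradient_ae_eq_zero` — `tr G = 0` a.e. for the weak gradient of a
  weakly divergence-free field.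
* `steadyEuler_test_of_weakGradient` — **the steady weak Euler identity extends to test fields
  `ψ ∈ L²` with compact support and whole-space weak gradient `Ψ ∈ L²`, `tr Ψ ∈ L³`**:
  `∫ ⟪F, ψ⟫ + ∫ ⟪V, Ψ(V)⟫ + ∫ P tr Ψ = 0` (vector mollification `φₙ ⋆ ψ`,
  `D(φₙ ⋆ ψ) = φₙ ⋆ Ψ → Ψ` in `L²`, `div(φₙ ⋆ ψ) = φₙ ⋆ tr Ψ → tr Ψ` in `L³`, Hölder).
* `IsWeaklyDivFree.integral_mul_inner_weakGradient_self` — the cubic term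
  `∫ σ ⟪V, G(V)⟫ = -½ ∫ ‖V‖² ⟪V, ∇σ⟫` for `V ∈ L⁴_loc`, `G ∈ L²_loc` (Sohr (III.3.7.11)–(13));
  the tree's local Serrin identity `integral_fderiv_apply_mul_inner_add_eq_zero`
  (`LocalTrilinearSkew.lean`, `ℝ³`, `c, d ∈ L⁶ ∩ W^{1,2}` on a ball, `b ∈ L³`) is the same
  mechanism with three different fields; here one field, any `E`, `L⁴_loc`, whole-space cutoff.
* `steadyEuler_localEnergyIdentity` — **the two-sided local energy identity**: for every real
  test function `σ`, `∫ σ ⟪F, V⟫ + ∫ (‖V‖²/2 + P) ⟪V, ∇σ⟫ = 0`.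
* `integral_mul_inner_weakGradient_apply_id` — the linear self-similar term:
  `∫ σ ⟪G(x) x, V x⟫ = -½ ∫ ‖V‖² (dim E · σ + ⟪x, ∇σ⟫)` (`V, G ∈ L²_loc`), and
  `selfSimilarProfile_localEnergyIdentity` — the identity for the forcing `F = a V + b (x·∇)V`:
  `a ∫ σ‖V‖² − (b/2) ∫ ‖V‖² (dim E · σ + ⟪x, ∇σ⟫) + ∫ (‖V‖²/2 + P) ⟪V, ∇σ⟫ = 0`
  (Chae–Shvydkoy 2013, (2.1) and §2.2: the local energy equality in self-similar variables, there
  under `C¹_loc`; here for `H¹_loc` profiles).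
* `memLp_six_ball_of_hasWeakGradient`, `memLp_four_ball_of_hasWeakGradient` — in dimension three,
  `V, G ∈ L²(B(0,R))` give `V ∈ L⁶(B(0,R)) ⊂ L⁴(B(0,R))` (the hypothesis `hV4`).
* Public tools: `isTestFunctionOn_normed_convolution`, `tendsto_eLpNorm_normed_convolution_sub`,
  `tendsto_eLpNorm_fderiv_normed_convolution_sub` (vector mollification against a whole-space weak
  gradient), `ae_weakGradient_eq_zero_of_not_mem_tsupport`; the Hölder bookkeeping
  (pairings under `L^q` convergence, the triples `(3, 3/2, 1)`, `(4, 4/3, 1)`, `(2, 4, 4/3)`) is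
  private.

## Why (consumer)

For an exactly self-similar member of Seregin's Euler class the time dependence is explicit, the
profile `V` has `∇V ∈ L²_loc(ℝ³)` (the `E`-gauge) and solves a steady-type identity of the above
shape; the file turns the distributional Euler identity into the two-sided profile energy balance
(Chae–Shvydkoy's starting point (2.9), there assumed via `C¹_loc`), without any Onsager-type
regularity — the "momentum-identity lever" that LEI-only strata lack (route №10, crux E, rung C1;
the member ⇒ weak-profile-equation dictionary entry is Summits-side work).
WHAT THIS IS NOT: not NS, not the crux — a functional-analytic tool.

## Mathlib / tree search

`lean search 'mollif|IsWeaklyDivFree.|DivFreeSobolevTesting|trace.*weakGrad|hasFDerivAt_convolution'`: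
the tree has mollification vs. weak derivatives on the whole space
(`HasWeakFDerivOn.fderiv_convolution_apply`, `…hasFDerivAt_convolution`), `L^p` convergence of
mollifiers (`tendsto_eLpNorm_normed_convolution_sub_self`), the weak product/chain rules
(`HasWeakFDerivOn.smul_contDiff`, `hasWeakFDerivOn_norm_sq`), extension by zero
(`hasWeakFDerivOn_indicator_smul`, `HasWeakFDerivOn.top_of_eq_zero_off`), divergence-free testing
of `W^{1,3/2}_c` functions on `ℝ³` (`IsWeaklyDivFree.integral_weakDeriv_apply_eq_zero`) and the
local Serrin identity on `ℝ³` (`integral_fderiv_apply_mul_inner_add_eq_zero`), the cutoff version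
for smooth `θ` (`IsWeaklyDivFree.integral_fderiv_apply_eq_zero`), a space–time trace lemma
(`SerrinBoundedHolder.ae_trace_eq_zero`) and the Sobolev embedding on bounded Lipschitz domains
(`exists_eLpNorm_le_of_memSobolevDomain_one`, `isLipschitzDomain_ball`); Galdi's `L^{9/2}`
Liouville theorem is typed for smooth steady fields only (`Galdi2011_thmX95`).  Nothing tests a
steady weak momentum identity with a non-smooth vector field (vector mollification of the
identity itself). Mathlib: `eLpNorm_le_eLpNorm_mul_eLpNorm_of_nnnorm`, `MemLp.of_bilin`,
`tendsto_integral_of_L1'`, `ae_eq_zero_of_integral_contDiff_smul_eq_zero`,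
`HasCompactSupport.convolution`, `ContinuousLinearMap.integral_comp_comm`.

## References

* H. Sohr, *The Navier–Stokes Equations. An Elementary Functional Analytic Approach*,
  Birkhäuser (2001), Ch. III §3.7, (3.7.10)–(3.7.13) (`⟨u·∇v, v⟩ = ½⟨u, ∇|v|²⟩ = 0` for
  `u, v ∈ W^{1,2}_{0,σ}`, `n = 2, 3`, by density), Lemma III.3.2.1. [Sohr2001]
* D. Chae, R. Shvydkoy, *On formation of a locally self-similar collapse in the incompressible
  Euler equations*, ARMA 209 (2013) = arXiv:1201.6009, (2.1) (profile equation) and §2.2 (local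
  energy equality (2.9)). [ChaeShvydkoy2013]
* L. C. Evans, *Partial Differential Equations*, 2nd ed. (2010), §5.3.1 Thm. 1, App. C.4 Thm. 7.
  [Evans2010]
-/

noncomputable section

open MeasureTheory TopologicalSpace Set Function Filter Topology Metric ContinuousLinearMap
open scoped ENNReal NNReal Convolution InnerProductSpace RealInnerProductSpace ContDiff

namespace Literature.Analysis.FluidPDE

open Literature.Analysis.FunctionSpaces

-- nested operator types (`smulRight`, `innerSL … ∘L …`)
set_option maxSynthPendingDepth 3

variable {E : Type*} [NormedAddCommGroup E] [InnerProductSpace ℝ E] [FiniteDimensional ℝ E]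
  [MeasurableSpace E] [BorelSpace E]

/-! ### Preliminaries: a Hölder triple, measurability on balls, pairings under `L^p` convergence -/

section Prelim

/-- The exponents `3` and `3/2` are Hölder conjugate in `ℝ≥0∞`: `3⁻¹ + (3/2)⁻¹ = 1`. [folklore] -/
private theorem holderTriple_three_threeHalves : ENNReal.HolderTriple 3 (3 / 2) 1 where
  inv_add_inv_eq_inv := by
    rw [ENNReal.inv_div (Or.inr (by norm_num)) (Or.inr (by norm_num)), inv_one, ← one_div,
      ENNReal.div_add_div_same]
    have h : (1 : ℝ≥0∞) + 2 = 3 := by norm_num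
    rw [h, ENNReal.div_self (by norm_num) (by norm_num)]

/-- The exponents `4` and `4/3` are Hölder conjugate in `ℝ≥0∞`: `4⁻¹ + (4/3)⁻¹ = 1`. [folklore] -/
private theorem holderTriple_four_fourThirds_one : ENNReal.HolderTriple 4 (4 / 3) 1 where
  inv_add_inv_eq_inv := by
    rw [ENNReal.inv_div (Or.inr (by norm_num)) (Or.inr (by norm_num)), inv_one, ← one_div,
      ENNReal.div_add_div_same]
    have h : (1 : ℝ≥0∞) + 3 = 4 := by norm_num
    rw [h, ENNReal.div_self (by norm_num) (by norm_num)]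

/-- The Hölder triple `2⁻¹ + 4⁻¹ = (4/3)⁻¹` (`L² · L⁴ ⊂ L^{4/3}`). [folklore] -/
private theorem holderTriple_two_four_fourThirds : ENNReal.HolderTriple 2 4 (4 / 3) where
  inv_add_inv_eq_inv := by
    have h1 : (2 : ℝ≥0∞)⁻¹ + 4⁻¹ ≠ ⊤ := ENNReal.add_ne_top.2
      ⟨ENNReal.inv_ne_top.2 (by norm_num), ENNReal.inv_ne_top.2 (by norm_num)⟩
    have h2 : ((4 : ℝ≥0∞) / 3)⁻¹ ≠ ⊤ := by
      rw [ENNReal.inv_div (Or.inr (by norm_num)) (Or.inr (by norm_num))]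
      exact ENNReal.div_ne_top (by norm_num) (by norm_num)
    rw [← ENNReal.toReal_eq_toReal_iff' h1 h2, ENNReal.toReal_add (ENNReal.inv_ne_top.2 (by norm_num))
      (ENNReal.inv_ne_top.2 (by norm_num)), ENNReal.toReal_inv, ENNReal.toReal_inv, ENNReal.toReal_inv,
      ENNReal.toReal_div]
    norm_num

/-- `‖V‖² ∈ L²` when `V ∈ L⁴`. [folklore] -/
private theorem memLp_two_norm_sq_of_memLp_four {α : Type*} [MeasurableSpace α] {μ : Measure α}
    {F' : Type*} [NormedAddCommGroup F'] {V : α → F'} (h : MemLp V 4 μ) :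
    MemLp (fun x => ‖V x‖ ^ 2) 2 μ := by
  have h1 := h.norm_rpow_div 2
  have e : (4 : ℝ≥0∞) / 2 = 2 := by
    have : (4 : ℝ≥0∞) = 2 * 2 := by norm_num
    rw [this, ENNReal.mul_div_cancel_right (by norm_num) (by norm_num)]
  rw [e] at h1
  refine h1.congr_norm ?_ (Eventually.of_forall fun x => ?_)  -- same function up to `rpow` vs `pow`
  · exact (h.1.norm.pow 2)
  · rw [ENNReal.toReal_ofNat, Real.rpow_two]

omit [InnerProductSpace ℝ E] [FiniteDimensional ℝ E] [BorelSpace E] in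
/-- A function which is a.e.-strongly measurable on every ball `B(0, n)` is a.e.-strongly
measurable (for any measure). [folklore] -/
private theorem aestronglyMeasurable_of_forall_ball [NormedSpace ℝ E] {F' : Type*} [TopologicalSpace F']
    [TopologicalSpace.PseudoMetrizableSpace F'] {μ : Measure E} {f : E → F'}
    (h : ∀ n : ℕ, AEStronglyMeasurable f (μ.restrict (ball (0 : E) n))) :
    AEStronglyMeasurable f μ := by
  have h' : AEStronglyMeasurable f (μ.restrict (⋃ n : ℕ, ball (0 : E) n)) :=
    aestronglyMeasurable_iUnion_iff.2 h
  rwa [iUnion_ball_nat, Measure.restrict_univ] at h'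

variable {α : Type*} [MeasurableSpace α] {μ : Measure α}
  {F₁ F₂ F₃ : Type*} [NormedAddCommGroup F₁] [NormedAddCommGroup F₂] [NormedAddCommGroup F₃]

/-- **`L^r` convergence of a pointwise pairing** (Hölder): if `‖b a c‖ ≤ C ‖a‖ ‖c‖`, `b a` is
additive-compatible in the second slot (`b a c - b a c' = b a (c - c')`), `f ∈ L^p`, and
`gᵢ → g` in `L^q` with `p⁻¹ + q⁻¹ = r⁻¹`, then `b(f, gᵢ) → b(f, g)` in `L^r`. [folklore] -/
private theorem tendsto_eLpNorm_pairing_sub {ι : Type*} {l : Filter ι} {p q r : ℝ≥0∞}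
    (hpqr : ENNReal.HolderTriple p q r) (b : F₁ → F₂ → F₃) (C : ℝ≥0)
    (hb : ∀ a c, ‖b a c‖ ≤ C * ‖a‖ * ‖c‖) (hsub : ∀ a c c', b a c - b a c' = b a (c - c'))
    {f : α → F₁} (hf : MemLp f p μ) {g : ι → α → F₂} {g₀ : α → F₂}
    (hg : ∀ i, AEStronglyMeasurable (g i) μ) (hg₀ : AEStronglyMeasurable g₀ μ)
    (h : Tendsto (fun i => eLpNorm (g i - g₀) q μ) l (𝓝 0)) :
    Tendsto (fun i => eLpNorm (fun x => b (f x) (g i x) - b (f x) (g₀ x)) r μ) l (𝓝 0) := by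
  have hle : ∀ i, eLpNorm (fun x => b (f x) (g i x) - b (f x) (g₀ x)) r μ ≤
      C * eLpNorm f p μ * eLpNorm (g i - g₀) q μ := by
    intro i
    have e : (fun x => b (f x) (g i x) - b (f x) (g₀ x)) = fun x => b (f x) ((g i - g₀) x) := by
      funext x; rw [hsub]; rfl
    rw [e]
    exact eLpNorm_le_eLpNorm_mul_eLpNorm'_of_norm hf.1 ((hg i).sub hg₀) b C
      (Eventually.of_forall fun x => hb _ _) (hpqr := hpqr)
  have hlim : Tendsto (fun i => (C : ℝ≥0∞) * eLpNorm f p μ * eLpNorm (g i - g₀) q μ) l (𝓝 0) := by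
    have := ENNReal.Tendsto.const_mul (a := (C : ℝ≥0∞) * eLpNorm f p μ) h
      (Or.inr (ENNReal.mul_ne_top ENNReal.coe_ne_top hf.2.ne))
    simpa only [mul_zero] using this
  exact tendsto_of_tendsto_of_tendsto_of_le_of_le tendsto_const_nhds hlim (fun _ => bot_le) hle

/-- **Integrals of a pointwise pairing under `L^q` convergence** (Hölder with `r = 1`): with `b`
as in `tendsto_eLpNorm_pairing_sub`, `f ∈ L^p`, `gᵢ, g ∈ L^q`, `p⁻¹ + q⁻¹ = 1` and
`‖gᵢ - g‖_q → 0`, the integrals `∫ b(f, gᵢ)` converge to `∫ b(f, g)`. [folklore] -/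
private theorem tendsto_integral_pairing [NormedSpace ℝ F₃] [CompleteSpace F₃] {ι : Type*} {l : Filter ι}
    {p q : ℝ≥0∞} (hpq : ENNReal.HolderTriple p q 1) (b : F₁ → F₂ → F₃) (C : ℝ≥0)
    (hb : ∀ a c, ‖b a c‖ ≤ C * ‖a‖ * ‖c‖) (hsub : ∀ a c c', b a c - b a c' = b a (c - c'))
    {f : α → F₁} (hf : MemLp f p μ) {g : ι → α → F₂} {g₀ : α → F₂}
    (hg : ∀ i, MemLp (g i) q μ) (hg₀ : MemLp g₀ q μ)
    (hbm : ∀ i, AEStronglyMeasurable (fun x => b (f x) (g i x)) μ)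
    (hbm₀ : AEStronglyMeasurable (fun x => b (f x) (g₀ x)) μ)
    (h : Tendsto (fun i => eLpNorm (g i - g₀) q μ) l (𝓝 0)) :
    Tendsto (fun i => ∫ x, b (f x) (g i x) ∂μ) l (𝓝 (∫ x, b (f x) (g₀ x) ∂μ)) := by
  have hb' : ∀ (h' : α → F₂) , ∀ᵐ x ∂μ, ‖b (f x) (h' x)‖₊ ≤ C * ‖f x‖₊ * ‖h' x‖₊ :=
    fun h' => Eventually.of_forall fun x => by
      have := hb (f x) (h' x)
      exact_mod_cast this
  have hint : ∀ i, Integrable (fun x => b (f x) (g i x)) μ := fun i =>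
    memLp_one_iff_integrable.1 (MemLp.of_bilin b C hf (hg i) (hbm i) (hb' _) (hpqr := hpq))
  refine tendsto_integral_of_L1' _ hbm₀ (Eventually.of_forall hint) ?_
  have := tendsto_eLpNorm_pairing_sub hpq b C hb hsub hf (fun i => (hg i).1) hg₀.1 h
  refine this.congr fun i => ?_
  rfl

end Prelim

/-! ### Mollification of a compactly supported field with a whole-space weak gradient -/

section Mollify

variable {F' : Type*} [NormedAddCommGroup F'] [NormedSpace ℝ F']

/-- The mollification `φ.normed ⋆ ψ` of a compactly supported, locally integrable `ψ` by a
normalised bump kernel is a (vector-valued) test function on the whole space: smooth and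
compactly supported (Evans, *PDE*, App. C.4, Thm. 7). [cite: Evans2010, App. C.4 Thm. 7] -/
theorem isTestFunctionOn_normed_convolution (φ : ContDiffBump (0 : E)) {ψ : E → F'}
    (hψc : HasCompactSupport ψ) (hψ : LocallyIntegrable ψ volume) :
    IsTestFunctionOn (⊤ : Opens E) (φ.normed volume ⋆[lsmul ℝ ℝ, volume] ψ) where
  contDiff := φ.hasCompactSupport_normed.contDiff_convolution_left _ φ.contDiff_normed hψ
  hasCompactSupport := φ.hasCompactSupport_normed.convolution _ hψc
  tsupport_subset := by simp

/-- A continuous linear map commutes with mollification by a normalised bump kernel: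
`ℓ ((φ.normed ⋆ g) x) = (φ.normed ⋆ (ℓ ∘ g)) x` for locally integrable `g` (the convolution
integral exists, and `ℓ` passes under the Bochner integral). [folklore] -/
private theorem clm_apply_normed_convolution [CompleteSpace F'] {F'' : Type*} [NormedAddCommGroup F'']
    [NormedSpace ℝ F''] [CompleteSpace F''] (ℓ : F' →L[ℝ] F'') (φ : ContDiffBump (0 : E))
    {g : E → F'} (hg : LocallyIntegrable g volume) (x : E) :
    ℓ ((φ.normed volume ⋆[lsmul ℝ ℝ, volume] g) x) =
      (φ.normed volume ⋆[lsmul ℝ ℝ, volume] fun y => ℓ (g y)) x := by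
  have hint : ConvolutionExistsAt (φ.normed volume) g x (lsmul ℝ ℝ) volume :=
    φ.hasCompactSupport_normed.convolutionExists_left _ φ.continuous_normed hg x
  rw [convolution_def, convolution_def, ← ℓ.integral_comp_comm hint.integrable]
  simp only [lsmul_apply, map_smul]

/-- **Mollifications of a compactly supported `L^q` function converge in `L^q`** along any
bump sequence with outer radii `→ 0` (`1 ≤ q < ∞`; Adams–Fournier Thm. 2.29 (c), the tree's
`tendsto_eLpNorm_normed_convolution_sub_self`), restated for the whole-space `volume`. [cite: AdamsFournier2003, Thm. 2.29 (c)] -/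
theorem tendsto_eLpNorm_normed_convolution_sub [CompleteSpace F'] {φ : ℕ → ContDiffBump (0 : E)}
    (hφ : Tendsto (fun n => (φ n).rOut) atTop (𝓝 0)) {q : ℝ≥0∞} (hq : 1 ≤ q) (hq' : q ≠ ⊤)
    {ψ : E → F'} (hψ : MemLp ψ q volume) :
    Tendsto (fun n => eLpNorm ((φ n).normed volume ⋆[lsmul ℝ ℝ, volume] ψ - ψ) q volume)
      atTop (𝓝 0) :=
  tendsto_eLpNorm_normed_convolution_sub_self hφ hq hq' hψ

/-- **Derivatives of the mollification converge to the weak gradient in `L^s`**: if `ψ` has the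
whole-space weak gradient `Ψ` with components `x ↦ Ψ x v` in `L^s` (`1 ≤ s < ∞`), then
`∂ᵥ(φₙ ⋆ ψ) = φₙ ⋆ (Ψ · v) → Ψ · v` in `L^s` (Evans, *PDE*, §5.3.1 Thm. 1: `Dᵅuᵋ = ηε ⋆ Dᵅu → Dᵅu`). [cite: Evans2010, §5.3.1 Thm. 1] -/
theorem tendsto_eLpNorm_fderiv_normed_convolution_sub [CompleteSpace F'] {φ : ℕ → ContDiffBump (0 : E)}
    (hφ : Tendsto (fun n => (φ n).rOut) atTop (𝓝 0)) {s : ℝ≥0∞} (hs : 1 ≤ s) (hs' : s ≠ ⊤)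
    {ψ : E → F'} {Ψ : E → E →L[ℝ] F'} (hΨ : HasWeakFDerivOn (⊤ : Opens E) volume ψ Ψ) (v : E)
    (hΨs : MemLp (fun x => Ψ x v) s volume) :
    Tendsto (fun n => eLpNorm ((fun x => fderiv ℝ ((φ n).normed volume ⋆[lsmul ℝ ℝ, volume] ψ) x v) -
      fun x => Ψ x v) s volume) atTop (𝓝 0) := by
  have e : ∀ n, (fun x => fderiv ℝ ((φ n).normed volume ⋆[lsmul ℝ ℝ, volume] ψ) x v) =
      (φ n).normed volume ⋆[lsmul ℝ ℝ, volume] fun x => Ψ x v := fun n =>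
    funext fun x => hΨ.fderiv_convolution_apply (isTestFunctionOn_normed (φ n)) x v
  simp_rw [e]
  exact tendsto_eLpNorm_normed_convolution_sub_self hφ hs hs' hΨs

end Mollify

/-! ### Weak gradients vanish off the support; finite-dimensional bookkeeping -/

section Support

variable {F' : Type*} [NormedAddCommGroup F'] [NormedSpace ℝ F']

omit [InnerProductSpace ℝ E] [FiniteDimensional ℝ E] [BorelSpace E] in
/-- A continuous linear map of a locally integrable function is locally integrable (Mathlib's
`ContinuousLinearMap.locallyIntegrableOn_comp` on `univ`). [folklore] -/
private theorem locallyIntegrable_clm_comp [NormedSpace ℝ E] {F'' : Type*} [NormedAddCommGroup F'']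
    [NormedSpace ℝ F''] {μ : Measure E} (L : F' →L[ℝ] F'') {f : E → F'}
    (hf : LocallyIntegrable f μ) : LocallyIntegrable (fun x => L (f x)) μ :=
  locallyIntegrableOn_univ.1 (L.locallyIntegrableOn_comp (locallyIntegrableOn_univ.2 hf))

/-- The real product as a pairing: `‖a c‖₊ ≤ 1 · ‖a‖₊ ‖c‖₊`. [folklore] -/
private theorem nnnorm_mul_le_one_mul (a c : ℝ) : ‖a * c‖₊ ≤ 1 * ‖a‖₊ * ‖c‖₊ := by
  rw [one_mul, nnnorm_mul]

/-- The real inner product as a pairing: `‖⟪a, c⟫‖₊ ≤ 1 · ‖a‖₊ ‖c‖₊`. [folklore] -/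
private theorem nnnorm_inner_le_one_mul {F'' : Type*} [NormedAddCommGroup F''] [InnerProductSpace ℝ F'']
    (a c : F'') : ‖⟪a, c⟫‖₊ ≤ 1 * ‖a‖₊ * ‖c‖₊ := by
  rw [one_mul, ← NNReal.coe_le_coe]
  push_cast
  exact norm_inner_le_norm a c

/-- **A whole-space weak derivative vanishes a.e. outside the topological support of the
function** (uniqueness of weak derivatives on the open set `(tsupport θ)ᶜ`, where `θ = 0`;
Evans, *PDE*, §5.2.1). [cite: Evans2010, §5.2.1 (remark after the Definition: uniqueness of weak derivatives)] -/
theorem ae_weakGradient_eq_zero_of_not_mem_tsupport [CompleteSpace F'] {μ : Measure E}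
    {θ : E → F'} {Θ : E → E →L[ℝ] F'} (hΘ : HasWeakFDerivOn (⊤ : Opens E) μ θ Θ) :
    ∀ᵐ x ∂μ, x ∉ tsupport θ → Θ x = 0 := by
  set U : Set E := (tsupport θ)ᶜ with hU
  have hUo : IsOpen U := (isClosed_tsupport θ).isOpen_compl
  have hΘli : LocallyIntegrable Θ μ := locallyIntegrableOn_univ.1 (by
    simpa only [Opens.coe_top] using hΘ.locallyIntegrableOn_deriv)
  -- each component vanishes a.e. on `U`
  have hcomp : ∀ v : E, ∀ᵐ x ∂μ, x ∈ U → Θ x v = 0 := by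
    intro v
    have hli : LocallyIntegrableOn (fun x => Θ x v) U μ :=
      (locallyIntegrable_clm_comp (ContinuousLinearMap.apply ℝ F' v) hΘli).locallyIntegrableOn U
    refine hUo.ae_eq_zero_of_integral_contDiff_smul_eq_zero hli fun g hg hgc hgU => ?_
    have hgt : IsTestFunctionOn (⊤ : Opens E) g := ⟨hg, hgc, by simp⟩
    have key := hΘ.integral_fderiv_smul_eq g v hgt
    simp only [Opens.coe_top, Measure.restrict_univ] at key
    -- the left-hand side vanishes: `∂ᵥ g` is supported in `U`, where `θ = 0`
    have hzero : ∫ x, (fderiv ℝ g x v) • θ x ∂μ = 0 := by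
      refine integral_eq_zero_of_ae (Eventually.of_forall fun x => ?_)
      by_cases hx : x ∈ tsupport θ
      · have hx' : x ∉ tsupport fun y => fderiv ℝ g y v := fun h' =>
          (hgU ((tsupport_fderiv_apply_subset ℝ v) h')) hx
        simp [image_eq_zero_of_notMem_tsupport hx']
      · simp [image_eq_zero_of_notMem_tsupport hx]
    rw [hzero] at key
    have := key.symm
    rwa [neg_eq_zero] at this
  -- assemble over an orthonormal basis
  set b := stdOrthonormalBasis ℝ E with hb
  have hall : ∀ᵐ x ∂μ, ∀ i, x ∈ U → Θ x (b i) = 0 := ae_all_iff.2 fun i => hcomp (b i)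
  filter_upwards [hall] with x hx hxθ
  ext w
  rw [← b.sum_repr' w, map_sum]
  simp only [map_smul, zero_apply]
  exact Finset.sum_eq_zero fun i _ => by rw [hx i hxθ, smul_zero]

omit [MeasurableSpace E] [BorelSpace E] in
/-- Expansion of `L w` along the standard orthonormal basis `b` of `E`:
`L w = ∑ᵢ ⟪bᵢ, w⟫ • L bᵢ`. [folklore] -/
private theorem clm_apply_eq_sum_inner_smul_stdBasis (L : E →L[ℝ] F') (w : E) :
    L w = ∑ i, ⟪stdOrthonormalBasis ℝ E i, w⟫ • L (stdOrthonormalBasis ℝ E i) := by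
  conv_lhs => rw [← (stdOrthonormalBasis ℝ E).sum_repr' w]
  rw [map_sum]
  simp only [map_smul]

omit [MeasurableSpace E] [BorelSpace E] in
/-- `⟪V x, ∇θ x⟫ = ∑ᵢ ⟪bᵢ, V x⟫ ∂ᵢθ(x)` along the standard orthonormal basis. [folklore] -/
private theorem inner_gradient_eq_sum (θ : E → ℝ) (w x : E) :
    ⟪w, gradient θ x⟫ = ∑ i, ⟪stdOrthonormalBasis ℝ E i, w⟫ * fderiv ℝ θ x (stdOrthonormalBasis ℝ E i) := by
  rw [real_inner_comm, inner_gradient_left, clm_apply_eq_sum_inner_smul_stdBasis (fderiv ℝ θ x) w]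
  simp only [smul_eq_mul]

end Support

/-! ### Divergence-free testing beyond smooth test functions -/

section DivFree

open scoped Pointwise

variable {V : E → E}

omit [MeasurableSpace E] [BorelSpace E] in
/-- The mollification of `θ` by a bump of outer radius `≤ 1` vanishes, together with its
derivative, outside `closedBall 0 1 + tsupport θ`. [folklore] -/
private theorem fderiv_normed_convolution_eq_zero [MeasurableSpace E] [BorelSpace E] {F' : Type*} [NormedAddCommGroup F']
    [NormedSpace ℝ F'] (φ : ContDiffBump (0 : E)) (hφ : φ.rOut ≤ 1) {θ : E → F'}
    (hθc : HasCompactSupport θ) {x : E} (hx : x ∉ closedBall (0 : E) 1 + tsupport θ) :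
    fderiv ℝ (φ.normed volume ⋆[lsmul ℝ ℝ, volume] θ) x = 0 := by
  refine fderiv_of_notMem_tsupport (𝕜 := ℝ) fun hx2 => ?_
  have hcl : IsClosed (closedBall (0 : E) 1 + tsupport θ) :=
    ((isCompact_closedBall (0 : E) 1).add hθc).isClosed
  have hsub : support (φ.normed volume ⋆[lsmul ℝ ℝ, volume] θ) ⊆ closedBall (0 : E) 1 + tsupport θ :=
    fun y hy => by
      by_contra hy'
      exact hy (normed_convolution_eq_zero_of_not_mem φ hφ hy')
  exact hx (closure_minimal hsub hcl hx2)

/-- **Divergence-free testing extends to compactly supported `W^{1,q}` functions.**  Let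
`V ∈ L^p(B(0,r))` for every `r` be weakly divergence free (`∫ ⟪V, ∇θ⟫ = 0` for smooth compactly
supported `θ`), and let `θ` be compactly supported with a whole-space weak gradient `Θ ∈ L^q`,
`p⁻¹ + q⁻¹ = 1`, `1 ≤ q < ∞`.  Then `∫ Θ(x)(V x) dx = 0`.  Proof: mollify, `θₙ = φₙ ⋆ θ` is a
test function with `∇θₙ = φₙ ⋆ Θ → Θ` in `L^q`, all supported in one compact set, and pass to
the limit in `∫ ⟪V, ∇θₙ⟫ = 0` by Hölder (Sohr 2001, (III.3.7.13): the density step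
`⟨u, ∇|v|²⟩ = lim ⟨uⱼ, ∇|v|²⟩`). [cite: Sohr2001, Ch. III (3.7.13)] -/
theorem IsWeaklyDivFree.integral_weakGradient_apply_eq_zero {p q : ℝ≥0∞}
    (hpq : ENNReal.HolderTriple p q 1) (hq : 1 ≤ q) (hq' : q ≠ ⊤) (hdiv : IsWeaklyDivFree V)
    (hVp : ∀ r : ℝ, MemLp V p (volume.restrict (ball (0 : E) r)))
    {θ : E → ℝ} {Θ : E → E →L[ℝ] ℝ} (hθc : HasCompactSupport θ) (hΘ : HasWeakGradient θ Θ)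
    (hΘq : MemLp Θ q volume) :
    ∫ x, Θ x (V x) = 0 := by
  -- a mollifier sequence and the mollified test functions
  obtain ⟨φ, hφ, -⟩ := exists_contDiffBump_seq (E := E)
  have hθli : LocallyIntegrable θ volume := locallyIntegrableOn_univ.1 (by
    simpa only [Opens.coe_top] using hΘ.locallyIntegrableOn)
  set θn : ℕ → E → ℝ := fun n => (φ n).normed volume ⋆[lsmul ℝ ℝ, volume] θ with hθn
  have hθn_test : ∀ n, IsTestFunctionOn (⊤ : Opens E) (θn n) := fun n =>
    isTestFunctionOn_normed_convolution (φ n) hθc hθli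
  have hzero : ∀ n, ∫ x, ⟪V x, gradient (θn n) x⟫ = 0 := fun n => hdiv (θn n) (hθn_test n)
  -- a ball containing the supports of all `θₙ` with `rOut(φₙ) ≤ 1`
  obtain ⟨R, hR⟩ : ∃ R : ℝ, closedBall (0 : E) 1 + tsupport θ ⊆ ball (0 : E) R := by
    obtain ⟨R, -, hR⟩ := ((isCompact_closedBall (0 : E) 1).add hθc).isBounded.subset_ball_lt 0 0
    exact ⟨R, hR⟩
  have hev : ∀ᶠ n in atTop, (φ n).rOut ≤ 1 := hφ.eventually (Iic_mem_nhds one_pos)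
  -- the standard basis and the `L^p` pieces of `V`
  set b := stdOrthonormalBasis ℝ E with hb
  set f : Fin (Module.finrank ℝ E) → E → ℝ := fun i =>
    (ball (0 : E) R).indicator fun x => ⟪b i, V x⟫ with hf
  have hfp : ∀ i, MemLp (f i) p volume := fun i =>
    (memLp_indicator_iff_restrict measurableSet_ball).2 ((hVp R).const_inner (b i))
  -- components of the gradients
  set g : ℕ → Fin (Module.finrank ℝ E) → E → ℝ := fun n i x => fderiv ℝ (θn n) x (b i) with hg
  have hg_eq : ∀ n i, g n i = (φ n).normed volume ⋆[lsmul ℝ ℝ, volume] fun x => Θ x (b i) :=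
    fun n i => funext fun x => hΘ.fderiv_convolution_apply (isTestFunctionOn_normed (φ n)) x (b i)
  have hΘiq : ∀ i, MemLp (fun x => Θ x (b i)) q volume := fun i =>
    MemLp.of_le_mul (c := ‖b i‖) hΘq
      ((ContinuousLinearMap.apply ℝ ℝ (b i)).continuous.comp_aestronglyMeasurable hΘq.1)
      (Eventually.of_forall fun x => by
        rw [mul_comm]; exact (Θ x).le_opNorm (b i))
  have hgq : ∀ n i, MemLp (g n i) q volume := fun n i => by
    rw [hg_eq]; exact memLp_normed_convolution (φ n) (hΘiq i) hq
  have hglim : ∀ i, Tendsto (fun n => eLpNorm (g n i - fun x => Θ x (b i)) q volume) atTop (𝓝 0) :=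
    fun i => tendsto_eLpNorm_fderiv_normed_convolution_sub hφ hq hq' hΘ (b i) (hΘiq i)
  -- the pairings converge
  have hpair : ∀ i, Tendsto (fun n => ∫ x, f i x * g n i x) atTop
      (𝓝 (∫ x, f i x * Θ x (b i))) := by
    intro i
    exact tendsto_integral_pairing hpq (fun a c : ℝ => a * c) 1
      (fun a c => by rw [norm_mul, NNReal.coe_one, one_mul]) (fun a c c' => (mul_sub a c c').symm)
      (hfp i) (hgq · i) (hΘiq i) (fun n => (hfp i).1.mul (hgq n i).1) ((hfp i).1.mul (hΘiq i).1)
      (hglim i)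
  have hsum : Tendsto (fun n => ∑ i, ∫ x, f i x * g n i x) atTop
      (𝓝 (∑ i, ∫ x, f i x * Θ x (b i))) := tendsto_finsetSum _ fun i _ => hpair i
  -- for `rOut ≤ 1` the sum is the divergence-free identity, hence `0`
  have hsum0 : ∀ᶠ n in atTop, ∑ i, ∫ x, f i x * g n i x = 0 := by
    filter_upwards [hev] with n hn
    have hsupp : ∀ x, x ∉ ball (0 : E) R → ∀ i, g n i x = 0 := by
      intro x hx i
      have hx' : x ∉ closedBall (0 : E) 1 + tsupport θ := fun h => hx (hR h)
      have : fderiv ℝ (θn n) x = 0 := fderiv_normed_convolution_eq_zero (φ n) hn hθc hx'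
      simp [hg, this]
    have e1 : ∀ i, (fun x => f i x * g n i x) = fun x => ⟪b i, V x⟫ * g n i x := by
      intro i; funext x
      by_cases hx : x ∈ ball (0 : E) R
      · simp [hf, indicator_of_mem hx]
      · simp [hf, indicator_of_notMem hx, hsupp x hx i]
    have hint : ∀ i, Integrable (fun x => f i x * g n i x) volume := fun i =>
      memLp_one_iff_integrable.1 (MemLp.of_bilin (fun a c : ℝ => a * c) 1 (hfp i) (hgq n i)
        ((hfp i).1.mul (hgq n i).1) (Eventually.of_forall fun x => nnnorm_mul_le_one_mul _ _)
        (hpqr := hpq))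
    rw [← integral_finsetSum _ fun i _ => hint i, ← hzero n]
    refine integral_congr_ae (Eventually.of_forall fun x => ?_)
    show ∑ i, f i x * g n i x = ⟪V x, gradient (θn n) x⟫
    rw [inner_gradient_eq_sum (θn n) (V x) x]
    exact Finset.sum_congr rfl fun i _ => by rw [congrFun (e1 i) x]
  have hlim0 : (∑ i, ∫ x, f i x * Θ x (b i)) = 0 :=
    tendsto_nhds_unique hsum (tendsto_const_nhds.congr' (hsum0.mono fun n hn => hn.symm))
  -- identify the limit with `∫ Θ(V)` (`Θ = 0` a.e. off `tsupport θ ⊆ ball 0 R`)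
  have hΘ0 := ae_weakGradient_eq_zero_of_not_mem_tsupport hΘ
  have hint' : ∀ i, Integrable (fun x => f i x * Θ x (b i)) volume := fun i =>
    memLp_one_iff_integrable.1 (MemLp.of_bilin (fun a c : ℝ => a * c) 1 (hfp i) (hΘiq i)
      ((hfp i).1.mul (hΘiq i).1) (Eventually.of_forall fun x => nnnorm_mul_le_one_mul _ _)
      (hpqr := hpq))
  rw [← hlim0, ← integral_finsetSum _ fun i _ => hint' i]
  refine integral_congr_ae ?_
  filter_upwards [hΘ0] with x hx
  by_cases hxR : x ∈ ball (0 : E) R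
  · rw [clm_apply_eq_sum_inner_smul_stdBasis (Θ x) (V x)]
    simp only [hf, indicator_of_mem hxR, smul_eq_mul]
    rfl
  · have hxθ : x ∉ tsupport θ := fun h =>
      hxR (hR ⟨0, mem_closedBall_self zero_le_one, x, h, by simp⟩)
    simp [hf, indicator_of_notMem hxR, hx hxθ]

/-- **`div V = 0` a.e. for the weak gradient**: if `V` is weakly divergence free and has the
whole-space weak gradient `G`, then `tr G(x) = 0` for a.e. `x` (test the weak-derivative
identity with `φ` in the directions of an orthonormal basis and sum: `∫ φ tr G = -∫ ⟪V, ∇φ⟫ = 0`,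
and the fundamental lemma of the calculus of variations; Evans, *PDE*, §5.2.1). [cite: Evans2010, §5.2.1] -/
theorem IsWeaklyDivFree.trace_weakGradient_ae_eq_zero {G : E → E →L[ℝ] E}
    (hdiv : IsWeaklyDivFree V) (hG : HasWeakGradient V G) :
    ∀ᵐ x ∂(volume : Measure E), LinearMap.trace ℝ E (G x : E →ₗ[ℝ] E) = 0 := by
  set b := stdOrthonormalBasis ℝ E with hb
  have hVli : LocallyIntegrable V volume := locallyIntegrableOn_univ.1 (by
    simpa only [Opens.coe_top] using hG.locallyIntegrableOn)
  have hGli : LocallyIntegrable G volume := locallyIntegrableOn_univ.1 (by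
    simpa only [Opens.coe_top] using hG.locallyIntegrableOn_deriv)
  have htr : ∀ x, LinearMap.trace ℝ E (G x : E →ₗ[ℝ] E) = ∑ i, ⟪b i, G x (b i)⟫ := fun x => by
    rw [LinearMap.trace_eq_sum_inner _ b]; rfl
  have hGi : ∀ i, LocallyIntegrable (fun x => ⟪b i, G x (b i)⟫) volume := fun i =>
    locallyIntegrable_clm_comp ((innerSL ℝ (b i)).comp (ContinuousLinearMap.apply ℝ E (b i))) hGli
  have hli : LocallyIntegrable (fun x => LinearMap.trace ℝ E (G x : E →ₗ[ℝ] E)) volume := by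
    simp_rw [htr]
    exact locallyIntegrable_finsetSum _ fun i _ => hGi i
  refine ae_eq_zero_of_integral_contDiff_smul_eq_zero hli fun g hg hgc => ?_
  have hgt : IsTestFunctionOn (⊤ : Opens E) g := ⟨hg, hgc, by simp⟩
  have hdgc : ∀ i, Continuous fun x => fderiv ℝ g x (b i) := fun i =>
    (hg.continuous_fderiv (by simp)).clm_apply continuous_const
  have hdgs : ∀ i, HasCompactSupport fun x => fderiv ℝ g x (b i) := fun i =>
    hgc.fderiv_apply (𝕜 := ℝ) (b i)
  -- `∫ g • ⟪bᵢ, G bᵢ⟫ = -∫ ∂ᵢ g ⟪bᵢ, V⟫`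
  have hcomp : ∀ i, ∫ x, g x • ⟪b i, G x (b i)⟫ = -∫ x, fderiv ℝ g x (b i) * ⟪b i, V x⟫ := by
    intro i
    have key := hG.integral_fderiv_smul_eq g (b i) hgt
    simp only [Opens.coe_top, Measure.restrict_univ] at key
    have hI1 : Integrable (fun x => (fderiv ℝ g x (b i)) • V x) volume :=
      hVli.integrable_smul_left_of_hasCompactSupport (hdgc i) (hdgs i)
    have hI2 : Integrable (fun x => g x • G x (b i)) volume :=
      (locallyIntegrable_clm_comp (ContinuousLinearMap.apply ℝ E (b i)) hGli)
        |>.integrable_smul_left_of_hasCompactSupport hg.continuous hgc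
    calc ∫ x, g x • ⟪b i, G x (b i)⟫ = ⟪b i, ∫ x, g x • G x (b i)⟫ := by
          rw [← integral_inner hI2]; simp only [inner_smul_right, smul_eq_mul]
      _ = ⟪b i, -∫ x, (fderiv ℝ g x (b i)) • V x⟫ := by rw [key, neg_neg]
      _ = -∫ x, fderiv ℝ g x (b i) * ⟪b i, V x⟫ := by
          rw [inner_neg_right, ← integral_inner hI1]; simp only [inner_smul_right]
  have hint : ∀ i, Integrable (fun x => g x • ⟪b i, G x (b i)⟫) volume := fun i =>
    (hGi i).integrable_smul_left_of_hasCompactSupport hg.continuous hgc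
  have hint2 : ∀ i, Integrable (fun x => fderiv ℝ g x (b i) * ⟪b i, V x⟫) volume := fun i =>
    (locallyIntegrable_clm_comp (innerSL ℝ (b i)) hVli).integrable_smul_left_of_hasCompactSupport
      (hdgc i) (hdgs i)
  calc ∫ x, g x • LinearMap.trace ℝ E (G x : E →ₗ[ℝ] E)
      = ∫ x, ∑ i, g x • ⟪b i, G x (b i)⟫ := by simp_rw [htr, Finset.smul_sum]
    _ = ∑ i, ∫ x, g x • ⟪b i, G x (b i)⟫ := integral_finsetSum _ fun i _ => hint i
    _ = -∑ i, ∫ x, fderiv ℝ g x (b i) * ⟪b i, V x⟫ := by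
        rw [Finset.sum_congr rfl fun i _ => hcomp i, Finset.sum_neg_distrib]
    _ = -∫ x, ∑ i, fderiv ℝ g x (b i) * ⟪b i, V x⟫ := by rw [integral_finsetSum _ fun i _ => hint2 i]
    _ = -∫ x, ⟪V x, gradient g x⟫ := by
        congr 1
        refine integral_congr_ae (Eventually.of_forall fun x => ?_)
        show ∑ i, fderiv ℝ g x (b i) * ⟪b i, V x⟫ = ⟪V x, gradient g x⟫
        rw [inner_gradient_eq_sum g (V x) x]
        exact Finset.sum_congr rfl fun i _ => mul_comm _ _
    _ = 0 := by rw [hdiv g hgt, neg_zero]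

end DivFree


/-! ### The momentum identity tested by fields with a weak gradient -/

section Momentum

open scoped Pointwise

variable {V F : E → E} {P : E → ℝ}

omit [MeasurableSpace E] [BorelSpace E] in
/-- The trace `tr L` of `L : E →L[ℝ] E` as a continuous linear functional of `L` (finite
dimension). [folklore] -/
private theorem exists_traceCLM :
    ∃ ℓ : (E →L[ℝ] E) →L[ℝ] ℝ, ∀ L : E →L[ℝ] E, ℓ L = LinearMap.trace ℝ E (L : E →ₗ[ℝ] E) :=
  ⟨LinearMap.toContinuousLinearMap ((LinearMap.trace ℝ E) ∘ₗ ContinuousLinearMap.coeLM ℝ),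
    fun _ => rfl⟩

omit [FiniteDimensional ℝ E] [MeasurableSpace E] [BorelSpace E] in
/-- The divergence is the trace of the Fréchet derivative (definitional). [folklore] -/
private theorem divergence_eq_trace_fderiv (ψ : E → E) (x : E) :
    VectorCalculus.divergence ψ x = LinearMap.trace ℝ E (fderiv ℝ ψ x : E →ₗ[ℝ] E) := rfl

omit [MeasurableSpace E] [BorelSpace E] in
/-- `⟪V x, L (V x)⟫ = ∑ᵢ ⟪⟪bᵢ, V x⟫ • V x, L bᵢ⟫` along the standard orthonormal basis. [folklore] -/
private theorem inner_clm_apply_self_eq_sum_stdBasis (L : E →L[ℝ] E) (w : E) :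
    ⟪w, L w⟫ = ∑ i, ⟪⟪stdOrthonormalBasis ℝ E i, w⟫ • w, L (stdOrthonormalBasis ℝ E i)⟫ := by
  conv_lhs => rw [clm_apply_eq_sum_inner_smul_stdBasis L w]
  rw [inner_sum]
  refine Finset.sum_congr rfl fun i _ => ?_
  rw [inner_smul_right, inner_smul_left]
  simp

/-- **The steady weak Euler identity extends to test fields with a weak gradient.**  Suppose
`V ∈ L⁴_loc`, `P ∈ L^{3/2}_loc`, `F ∈ L²_loc` (on all balls `B(0,r)`) and the steady weak
Euler identity with forcing holds for smooth compactly supported vector test fields: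
`∫ (⟪F, ψ⟫ + ⟪V, Dψ(V)⟫ + P div ψ) = 0`.  Then for every compactly supported `ψ ∈ L²` with
whole-space weak gradient `Ψ ∈ L²` and `tr Ψ ∈ L³`,
`∫ ⟪F, ψ⟫ + ∫ ⟪V, Ψ(V)⟫ + ∫ P tr Ψ = 0`.
Proof: `ψₙ = φₙ ⋆ ψ` are admissible, `ψₙ → ψ` in `L²`, `Dψₙ = φₙ ⋆ Ψ → Ψ` in `L²`,
`div ψₙ = φₙ ⋆ tr Ψ → tr Ψ` in `L³`, all supported in one ball, and each term passes to the
limit by Hölder (Sohr 2001, Lemma III.3.2.1 and (III.3.7.10)–(III.3.7.13): continuity of the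
trilinear form and density). [cite: Sohr2001, Ch. III (3.7.10)–(3.7.13)] -/
theorem steadyEuler_test_of_weakGradient
    (hV4 : ∀ r : ℝ, MemLp V 4 (volume.restrict (ball (0 : E) r)))
    (hP : ∀ r : ℝ, MemLp P (3 / 2) (volume.restrict (ball (0 : E) r)))
    (hF : ∀ r : ℝ, MemLp F 2 (volume.restrict (ball (0 : E) r)))
    (hEq : ∀ ψ : E → E, IsTestFunctionOn (⊤ : Opens E) ψ →
      ∫ x, (⟪F x, ψ x⟫ + ⟪V x, fderiv ℝ ψ x (V x)⟫ + P x * VectorCalculus.divergence ψ x) = 0)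
    {ψ : E → E} {Ψ : E → E →L[ℝ] E} (hψc : HasCompactSupport ψ) (hψ2 : MemLp ψ 2 volume)
    (hΨ : HasWeakGradient ψ Ψ) (hΨ2 : MemLp Ψ 2 volume)
    (hΨ3 : MemLp (fun x => LinearMap.trace ℝ E (Ψ x : E →ₗ[ℝ] E)) 3 volume) :
    (∫ x, ⟪F x, ψ x⟫) + (∫ x, ⟪V x, Ψ x (V x)⟫) +
      ∫ x, P x * LinearMap.trace ℝ E (Ψ x : E →ₗ[ℝ] E) = 0 := by
  -- mollifier sequence, mollified fields
  obtain ⟨φ, hφ, -⟩ := exists_contDiffBump_seq (E := E)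
  have hψli : LocallyIntegrable ψ volume := locallyIntegrableOn_univ.1 (by
    simpa only [Opens.coe_top] using hΨ.locallyIntegrableOn)
  have hΨli : LocallyIntegrable Ψ volume := locallyIntegrableOn_univ.1 (by
    simpa only [Opens.coe_top] using hΨ.locallyIntegrableOn_deriv)
  set ψn : ℕ → E → E := fun n => (φ n).normed volume ⋆[lsmul ℝ ℝ, volume] ψ with hψn
  have hψn_test : ∀ n, IsTestFunctionOn (⊤ : Opens E) (ψn n) := fun n =>
    isTestFunctionOn_normed_convolution (φ n) hψc hψli
  have hzero := fun n => hEq (ψn n) (hψn_test n)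
  -- a ball containing all supports
  obtain ⟨R, hR⟩ : ∃ R : ℝ, closedBall (0 : E) 1 + tsupport ψ ⊆ ball (0 : E) R := by
    obtain ⟨R, -, hR⟩ := ((isCompact_closedBall (0 : E) 1).add hψc).isBounded.subset_ball_lt 0 0
    exact ⟨R, hR⟩
  have hψR : tsupport ψ ⊆ ball (0 : E) R := fun x hx =>
    hR ⟨0, mem_closedBall_self zero_le_one, x, hx, by simp⟩
  have hev : ∀ᶠ n in atTop, (φ n).rOut ≤ 1 := hφ.eventually (Iic_mem_nhds one_pos)
  set b := stdOrthonormalBasis ℝ E with hb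
  obtain ⟨ℓ, hℓ⟩ := exists_traceCLM (E := E)
  -- truncated coefficients (globally in `L^p`)
  set FR : E → E := (ball (0 : E) R).indicator F with hFR
  have hFR2 : MemLp FR 2 volume := (memLp_indicator_iff_restrict measurableSet_ball).2 (hF R)
  set PR : E → ℝ := (ball (0 : E) R).indicator P with hPR
  have hPR32 : MemLp PR (3 / 2) volume := (memLp_indicator_iff_restrict measurableSet_ball).2 (hP R)
  set W : Fin (Module.finrank ℝ E) → E → E := fun i =>
    (ball (0 : E) R).indicator fun x => ⟪b i, V x⟫ • V x with hW
  have hW2 : ∀ i, MemLp (W i) 2 volume := by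
    intro i
    refine (memLp_indicator_iff_restrict measurableSet_ball).2 ?_
    refine MemLp.of_le_mul (c := ‖b i‖) (memLp_two_norm_sq_of_memLp_four (hV4 R))
      ((aestronglyMeasurable_const.inner (hV4 R).1).smul (hV4 R).1)
      (Eventually.of_forall fun x => ?_)
    rw [norm_smul, Real.norm_eq_abs, Real.norm_of_nonneg (sq_nonneg _), sq, ← mul_assoc]
    gcongr
    exact abs_real_inner_le_norm _ _
  -- the approximating sequences and their limits
  -- (a) the fields themselves
  have hψn2 : ∀ n, MemLp (ψn n) 2 volume := fun n => memLp_normed_convolution (φ n) hψ2 one_le_two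
  have hlimA : Tendsto (fun n => ∫ x, ⟪FR x, ψn n x⟫) atTop (𝓝 (∫ x, ⟪FR x, ψ x⟫)) :=
    tendsto_integral_pairing (inferInstance : ENNReal.HolderTriple 2 2 1) (fun a c : E => ⟪a, c⟫) 1
      (fun a c => by rw [NNReal.coe_one, one_mul]; exact norm_inner_le_norm a c)
      (fun a c c' => (inner_sub_right a c c').symm) hFR2 hψn2 hψ2
      (fun n => hFR2.1.inner (hψn2 n).1) (hFR2.1.inner hψ2.1)
      (tendsto_eLpNorm_normed_convolution_sub hφ one_le_two ENNReal.ofNat_ne_top hψ2)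
  -- (b) the gradient components
  set g : ℕ → Fin (Module.finrank ℝ E) → E → E := fun n i x => fderiv ℝ (ψn n) x (b i) with hg
  have hΨi2 : ∀ i, MemLp (fun x => Ψ x (b i)) 2 volume := fun i =>
    MemLp.of_le_mul (c := ‖b i‖) hΨ2
      ((ContinuousLinearMap.apply ℝ E (b i)).continuous.comp_aestronglyMeasurable hΨ2.1)
      (Eventually.of_forall fun x => by rw [mul_comm]; exact (Ψ x).le_opNorm (b i))
  have hg_eq : ∀ n i, g n i = (φ n).normed volume ⋆[lsmul ℝ ℝ, volume] fun x => Ψ x (b i) :=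
    fun n i => funext fun x => hΨ.fderiv_convolution_apply (isTestFunctionOn_normed (φ n)) x (b i)
  have hg2 : ∀ n i, MemLp (g n i) 2 volume := fun n i => by
    rw [hg_eq]; exact memLp_normed_convolution (φ n) (hΨi2 i) one_le_two
  have hlimB : ∀ i, Tendsto (fun n => ∫ x, ⟪W i x, g n i x⟫) atTop (𝓝 (∫ x, ⟪W i x, Ψ x (b i)⟫)) :=
    fun i => tendsto_integral_pairing (inferInstance : ENNReal.HolderTriple 2 2 1)
      (fun a c : E => ⟪a, c⟫) 1
      (fun a c => by rw [NNReal.coe_one, one_mul]; exact norm_inner_le_norm a c)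
      (fun a c c' => (inner_sub_right a c c').symm) (hW2 i) (hg2 · i) (hΨi2 i)
      (fun n => (hW2 i).1.inner (hg2 n i).1) ((hW2 i).1.inner (hΨi2 i).1)
      (tendsto_eLpNorm_fderiv_normed_convolution_sub hφ one_le_two ENNReal.ofNat_ne_top hΨ (b i)
        (hΨi2 i))
  -- (c) the divergences
  set d : ℕ → E → ℝ := fun n x => VectorCalculus.divergence (ψn n) x with hd
  have hd_eq : ∀ n, d n = (φ n).normed volume ⋆[lsmul ℝ ℝ, volume]
      fun x => LinearMap.trace ℝ E (Ψ x : E →ₗ[ℝ] E) := by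
    intro n; funext x
    simp only [hd, divergence_eq_trace_fderiv]
    rw [(hΨ.hasFDerivAt_convolution (isTestFunctionOn_normed (φ n)) x).fderiv, ← hℓ,
      clm_apply_normed_convolution ℓ (φ n) hΨli x]
    simp only [hℓ]
  have hd3 : ∀ n, MemLp (d n) 3 volume := fun n => by
    rw [hd_eq]; exact memLp_normed_convolution (φ n) hΨ3 (by norm_num)
  have hlimC : Tendsto (fun n => ∫ x, PR x * d n x) atTop
      (𝓝 (∫ x, PR x * LinearMap.trace ℝ E (Ψ x : E →ₗ[ℝ] E))) := by
    refine tendsto_integral_pairing (ENNReal.HolderTriple.symm (hpqr := holderTriple_three_threeHalves))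
      (fun a c : ℝ => a * c) 1 (fun a c => by rw [norm_mul, NNReal.coe_one, one_mul])
      (fun a c c' => (mul_sub a c c').symm) hPR32 hd3 hΨ3 (fun n => hPR32.1.mul (hd3 n).1)
      (hPR32.1.mul hΨ3.1) ?_
    have := tendsto_eLpNorm_normed_convolution_sub hφ (q := 3) (by norm_num) ENNReal.ofNat_ne_top hΨ3
    refine this.congr fun n => ?_
    rw [hd_eq]
  -- the tested identity, rewritten with the truncated coefficients, for `rOut ≤ 1`
  have hsplit : ∀ᶠ n in atTop,
      (∫ x, ⟪FR x, ψn n x⟫) + (∑ i, ∫ x, ⟪W i x, g n i x⟫) + ∫ x, PR x * d n x = 0 := by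
    filter_upwards [hev] with n hn
    have hoffψ : ∀ x, x ∉ ball (0 : E) R → ψn n x = 0 := fun x hx =>
      normed_convolution_eq_zero_of_not_mem (φ n) hn fun h => hx (hR h)
    have hoffD : ∀ x, x ∉ ball (0 : E) R → fderiv ℝ (ψn n) x = 0 := fun x hx =>
      fderiv_normed_convolution_eq_zero (φ n) hn hψc fun h => hx (hR h)
    -- pointwise identification of the three integrands
    have eA : ∀ x, ⟪F x, ψn n x⟫ = ⟪FR x, ψn n x⟫ := by
      intro x
      by_cases hx : x ∈ ball (0 : E) R
      · simp [hFR, indicator_of_mem hx]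
      · simp [hFR, indicator_of_notMem hx, hoffψ x hx]
    have eB : ∀ x, ⟪V x, fderiv ℝ (ψn n) x (V x)⟫ = ∑ i, ⟪W i x, g n i x⟫ := by
      intro x
      by_cases hx : x ∈ ball (0 : E) R
      · rw [inner_clm_apply_self_eq_sum_stdBasis]
        simp only [hW, hg, indicator_of_mem hx]
        rfl
      · simp [hW, hg, indicator_of_notMem hx, hoffD x hx]
    have eC : ∀ x, P x * VectorCalculus.divergence (ψn n) x = PR x * d n x := by
      intro x
      by_cases hx : x ∈ ball (0 : E) R
      · simp [hPR, hd, indicator_of_mem hx]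
      · simp [hPR, hd, indicator_of_notMem hx, divergence_eq_trace_fderiv, hoffD x hx]
    -- integrability of the truncated integrands
    have hIA : Integrable (fun x => ⟪FR x, ψn n x⟫) volume :=
      memLp_one_iff_integrable.1 (MemLp.of_bilin (fun a c : E => ⟪a, c⟫) 1 hFR2 (hψn2 n)
        (hFR2.1.inner (hψn2 n).1) (Eventually.of_forall fun x => nnnorm_inner_le_one_mul _ _))
    have hIB : ∀ i, Integrable (fun x => ⟪W i x, g n i x⟫) volume := fun i =>
      memLp_one_iff_integrable.1 (MemLp.of_bilin (fun a c : E => ⟪a, c⟫) 1 (hW2 i) (hg2 n i)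
        ((hW2 i).1.inner (hg2 n i).1) (Eventually.of_forall fun x => nnnorm_inner_le_one_mul _ _))
    have hIB' : Integrable (fun x => ∑ i, ⟪W i x, g n i x⟫) volume :=
      integrable_finsetSum _ fun i _ => hIB i
    have hIC : Integrable (fun x => PR x * d n x) volume :=
      memLp_one_iff_integrable.1 (MemLp.of_bilin (fun a c : ℝ => a * c) 1 hPR32 (hd3 n)
        (hPR32.1.mul (hd3 n).1) (Eventually.of_forall fun x => nnnorm_mul_le_one_mul _ _)
        (hpqr := ENNReal.HolderTriple.symm (hpqr := holderTriple_three_threeHalves)))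
    have hIAB : Integrable (fun x => ⟪FR x, ψn n x⟫ + ∑ i, ⟪W i x, g n i x⟫) volume := hIA.add hIB'
    have h0 := hzero n
    simp_rw [eA, eB, eC] at h0
    rw [integral_add hIAB hIC, integral_add hIA hIB', integral_finsetSum _ fun i _ => hIB i] at h0
    exact h0
  -- pass to the limit
  have hlim : Tendsto (fun n => (∫ x, ⟪FR x, ψn n x⟫) + (∑ i, ∫ x, ⟪W i x, g n i x⟫) + ∫ x, PR x * d n x)
      atTop (𝓝 ((∫ x, ⟪FR x, ψ x⟫) + (∑ i, ∫ x, ⟪W i x, Ψ x (b i)⟫) +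
        ∫ x, PR x * LinearMap.trace ℝ E (Ψ x : E →ₗ[ℝ] E))) :=
    (hlimA.add (tendsto_finsetSum _ fun i _ => hlimB i)).add hlimC
  have hval := tendsto_nhds_unique hlim (tendsto_const_nhds.congr' (hsplit.mono fun n hn => hn.symm))
  -- identify the limit with the claimed integrals (`ψ`, `Ψ` vanish (a.e.) off `ball 0 R`)
  have hΨ0 := ae_weakGradient_eq_zero_of_not_mem_tsupport hΨ
  have eA : (∫ x, ⟪FR x, ψ x⟫) = ∫ x, ⟪F x, ψ x⟫ := by
    refine integral_congr_ae (Eventually.of_forall fun x => ?_)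
    by_cases hx : x ∈ ball (0 : E) R
    · simp [hFR, indicator_of_mem hx]
    · simp [hFR, indicator_of_notMem hx, image_eq_zero_of_notMem_tsupport (fun h => hx (hψR h))]
  have hIB : ∀ i, Integrable (fun x => ⟪W i x, Ψ x (b i)⟫) volume := fun i =>
    memLp_one_iff_integrable.1 (MemLp.of_bilin (fun a c : E => ⟪a, c⟫) 1 (hW2 i) (hΨi2 i)
      ((hW2 i).1.inner (hΨi2 i).1) (Eventually.of_forall fun x => nnnorm_inner_le_one_mul _ _))
  have eB : (∑ i, ∫ x, ⟪W i x, Ψ x (b i)⟫) = ∫ x, ⟪V x, Ψ x (V x)⟫ := by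
    rw [← integral_finsetSum _ fun i _ => hIB i]
    refine integral_congr_ae ?_
    filter_upwards [hΨ0] with x hx
    by_cases hxR : x ∈ ball (0 : E) R
    · rw [inner_clm_apply_self_eq_sum_stdBasis (Ψ x) (V x)]
      simp only [hW, indicator_of_mem hxR]
      rfl
    · have : Ψ x = 0 := hx fun h => hxR (hψR h)
      simp [hW, indicator_of_notMem hxR, this]
  have eC : (∫ x, PR x * LinearMap.trace ℝ E (Ψ x : E →ₗ[ℝ] E)) =
      ∫ x, P x * LinearMap.trace ℝ E (Ψ x : E →ₗ[ℝ] E) := by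
    refine integral_congr_ae ?_
    filter_upwards [hΨ0] with x hx
    by_cases hxR : x ∈ ball (0 : E) R
    · simp [hPR, indicator_of_mem hxR]
    · have : Ψ x = 0 := hx fun h => hxR (hψR h)
      simp [hPR, indicator_of_notMem hxR, this]
  rw [eA, eB, eC] at hval
  exact hval

end Momentum


/-! ### The cubic term: `∫ σ ⟪V, (V·∇)V⟫ = -½ ∫ ‖V‖² ⟪V, ∇σ⟫` -/

section Cubic

variable {V : E → E} {G : E → E →L[ℝ] E}

omit [MeasurableSpace E] [BorelSpace E] in
/-- `(1 : ℝ≥0∞) ≤ 4/3` and `4/3 ≠ ∞`, `4/3 ≤ 2`. [folklore] -/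
private theorem fourThirds_facts : (1 : ℝ≥0∞) ≤ 4 / 3 ∧ (4 : ℝ≥0∞) / 3 ≠ ⊤ ∧ (4 : ℝ≥0∞) / 3 ≤ 2 := by
  refine ⟨?_, ENNReal.div_ne_top (by norm_num) (by norm_num), ?_⟩
  · rw [ENNReal.le_div_iff_mul_le (Or.inl (by norm_num)) (Or.inl (by norm_num))]; norm_num
  · rw [ENNReal.div_le_iff (by norm_num) (by norm_num)]; norm_num

omit [FiniteDimensional ℝ E] [BorelSpace E] in
/-- Evaluation `x ↦ G x (V x)` of an a.e.-strongly measurable operator field at an a.e.-strongly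
measurable vector field is a.e.-strongly measurable. [folklore] -/
private theorem aestronglyMeasurable_clm_apply_field {μ : Measure E} {F' : Type*} [NormedAddCommGroup F']
    [NormedSpace ℝ F'] {G' : E → E →L[ℝ] F'} {W : E → E} (hG : AEStronglyMeasurable G' μ)
    (hW : AEStronglyMeasurable W μ) : AEStronglyMeasurable (fun x => G' x (W x)) μ :=
  (isBoundedBilinearMap_apply (𝕜 := ℝ) (E := E) (F := F')).continuous.comp_aestronglyMeasurable
    (hG.prodMk hW)

omit [FiniteDimensional ℝ E] [MeasurableSpace E] [BorelSpace E] in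
/-- `‖c.smulRight r‖ ≤ ‖c‖ ‖r‖` for a functional `c` and a real scalar `r`. [folklore] -/
private theorem norm_smulRight_le_mul (c : E →L[ℝ] ℝ) (r : ℝ) : ‖c.smulRight r‖ ≤ ‖c‖ * ‖r‖ := by
  refine ContinuousLinearMap.opNorm_le_bound _ (by positivity) fun v => ?_
  rw [ContinuousLinearMap.smulRight_apply, norm_smul, mul_right_comm]
  gcongr
  exact c.le_opNorm v

/-- **The cubic term of the energy balance** (Sohr 2001, (III.3.7.11)–(III.3.7.13):
`⟨u·∇v, v⟩ = ½⟨u, ∇|v|²⟩ = -½⟨div u, |v|²⟩ = 0`, localised by a cutoff `σ`): for a weakly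
divergence-free `V ∈ L⁴_loc` with whole-space weak gradient `G ∈ L²_loc` and a real test
function `σ`,
`∫ σ ⟪V, G(V)⟫ = -½ ∫ ‖V‖² ⟪V, ∇σ⟫`.
Proof: `θ = σ‖V‖²` has the weak gradient `Θ = σ · 2⟨V, G ·⟩ + ‖V‖² Dσ ∈ L^{4/3}` (weak chain rule
`hasWeakFDerivOn_norm_sq` on a ball and extension by zero), and divergence-free testing extends
to it (`integral_weakGradient_apply_eq_zero` with `(p, q) = (4, 4/3)`). [cite: Sohr2001, Ch. III (3.7.11)–(3.7.13)] -/
theorem IsWeaklyDivFree.integral_mul_inner_weakGradient_self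
    (hV4 : ∀ r : ℝ, MemLp V 4 (volume.restrict (ball (0 : E) r)))
    (hG : HasWeakGradient V G)
    (hG2 : ∀ (r : ℝ) (v : E), MemLp (fun x => G x v) 2 (volume.restrict (ball (0 : E) r)))
    (hdiv : IsWeaklyDivFree V) {σ : E → ℝ} (hσ : IsTestFunctionOn (⊤ : Opens E) σ) :
    ∫ x, σ x * ⟪V x, G x (V x)⟫ = -(1 / 2) * ∫ x, ‖V x‖ ^ 2 * ⟪V x, gradient σ x⟫ := by
  obtain ⟨h43one, h43top, h43two⟩ := fourThirds_facts
  -- a ball containing the support of `σ`; bounds for `σ` and `Dσ`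
  obtain ⟨R, -, hR⟩ := hσ.hasCompactSupport.isCompact.isBounded.subset_ball_lt 0 0
  obtain ⟨Cσ, hCσ⟩ := hσ.contDiff.continuous.bounded_above_of_compact_support hσ.hasCompactSupport
  obtain ⟨Cd, hCd⟩ := (hσ.contDiff.continuous_fderiv (by simp)).bounded_above_of_compact_support
    (hσ.hasCompactSupport.fderiv ℝ)
  set Ω : Opens E := ⟨ball (0 : E) R, isOpen_ball⟩ with hΩ
  have hΩm : MeasurableSet (Ω : Set E) := measurableSet_ball
  haveI : IsFiniteMeasure (volume.restrict (Ω : Set E)) :=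
    isFiniteMeasure_restrict.2 measure_ball_lt_top.ne
  -- the data on the ball
  have hVm : AEStronglyMeasurable V volume := by
    have := hG.locallyIntegrableOn.aestronglyMeasurable
    simpa only [Opens.coe_top, Measure.restrict_univ] using this
  have hGm0 : AEStronglyMeasurable G volume := by
    have := hG.locallyIntegrableOn_deriv.aestronglyMeasurable
    simpa only [Opens.coe_top, Measure.restrict_univ] using this
  have hV4Ω : MemLp V 4 (volume.restrict (Ω : Set E)) := hV4 R
  have hV2Ω : MemLp V 2 (volume.restrict (Ω : Set E)) := hV4Ω.mono_exponent (by norm_num)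
  have hVsq2 : MemLp (fun x => ‖V x‖ ^ 2) 2 (volume.restrict (Ω : Set E)) :=
    memLp_two_norm_sq_of_memLp_four hV4Ω
  have hGΩ : HasWeakFDerivOn Ω volume V G := HasWeakFDerivOn.mono_set_holds hG le_top
  have hG2Ω : ∀ v, MemLp (fun x => G x v) 2 (volume.restrict (Ω : Set E)) := fun v => hG2 R v
  have hGm : AEStronglyMeasurable G (volume.restrict (Ω : Set E)) := hGm0.restrict
  have hGL2 : MemLp G 2 (volume.restrict (Ω : Set E)) := memLp_two_of_forall_apply hGm hG2Ω
  -- the weak gradient of `‖V‖²` on the ball: `N = 2 ⟨V, G ·⟩`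
  set N : E → E →L[ℝ] ℝ := fun x => (2 : ℝ) • (innerSL ℝ (V x)).comp (G x) with hN_def
  have hN : HasWeakFDerivOn Ω volume (fun x => ‖V x‖ ^ 2) N := hasWeakFDerivOn_norm_sq hV2Ω hGΩ hG2Ω
  have hNm : AEStronglyMeasurable N (volume.restrict (Ω : Set E)) :=
    hN.locallyIntegrableOn_deriv.aestronglyMeasurable
  have hprod : MemLp ((fun x => ‖G x‖) * fun x => ‖V x‖) (4 / 3) (volume.restrict (Ω : Set E)) :=
    MemLp.mul hV4Ω.norm hGL2.norm (hpqr := holderTriple_two_four_fourThirds)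
  have hN43 : MemLp N (4 / 3) (volume.restrict (Ω : Set E)) := by
    refine MemLp.of_le_mul (c := 2) hprod hNm (Eventually.of_forall fun x => ?_)
    rw [hN_def]
    simp only [Pi.mul_apply, Real.norm_eq_abs, abs_mul, abs_norm]
    calc ‖(2 : ℝ) • (innerSL ℝ (V x)).comp (G x)‖ = 2 * ‖(innerSL ℝ (V x)).comp (G x)‖ := by
          rw [norm_smul, Real.norm_two]
      _ ≤ 2 * (‖innerSL ℝ (V x)‖ * ‖G x‖) := by gcongr; exact opNorm_comp_le _ _
      _ = 2 * (‖G x‖ * ‖V x‖) := by rw [innerSL_apply_norm, mul_comm ‖V x‖]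
  -- extension by zero with the cutoff `σ`
  have hfi : LocallyIntegrable ((Ω : Set E).indicator fun x => ‖V x‖ ^ 2) volume :=
    locallyIntegrable_indicator_of_memLp (p := 2) (by norm_num) hVsq2
  have hgi : LocallyIntegrable ((Ω : Set E).indicator N) volume :=
    locallyIntegrable_indicator_of_memLp h43one hN43
  have hσΩ : tsupport σ ∩ ((⊤ : Opens E) : Set E) ⊆ Ω := fun x hx => hR hx.1
  have hΘ := hasWeakFDerivOn_indicator_smul (Ω' := (⊤ : Opens E)) hN hfi hgi hσ.contDiff hσΩ
  set θ : E → ℝ := (Ω : Set E).indicator fun x => σ x • ‖V x‖ ^ 2 with hθ_def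
  set Θ : E → E →L[ℝ] ℝ := (Ω : Set E).indicator fun x =>
    σ x • N x + (fderiv ℝ σ x).smulRight (‖V x‖ ^ 2) with hΘ_def
  have hθc : HasCompactSupport θ := by
    refine hσ.hasCompactSupport.mono fun x hx => ?_
    rw [mem_support] at hx ⊢
    intro h0
    refine hx ?_
    rw [hθ_def]
    by_cases hxΩ : x ∈ (Ω : Set E)
    · simp [indicator_of_mem hxΩ, h0]
    · simp [indicator_of_notMem hxΩ]
  -- `Θ ∈ L^{4/3}`
  have hCσ0 : 0 ≤ Cσ := (norm_nonneg _).trans (hCσ 0)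
  have hCd0 : 0 ≤ Cd := (norm_nonneg _).trans (hCd 0)
  have hΘ43 : MemLp Θ (4 / 3) volume := by
    rw [hΘ_def]
    refine (memLp_indicator_iff_restrict (μ := volume) (p := 4 / 3)
      (f := fun x => σ x • N x + (fderiv ℝ σ x).smulRight (‖V x‖ ^ 2)) hΩm).2 ?_
    have hΘmeas : AEStronglyMeasurable
        (fun x => σ x • N x + (fderiv ℝ σ x).smulRight (‖V x‖ ^ 2)) (volume.restrict (Ω : Set E)) := by
      have h1 : AEStronglyMeasurable Θ volume := by
        have := hΘ.locallyIntegrableOn_deriv.aestronglyMeasurable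
        simpa only [Opens.coe_top, Measure.restrict_univ] using this
      exact h1.restrict.congr (indicator_ae_eq_restrict hΩm)
    have hm : MemLp (fun x => Cσ * ‖N x‖ + Cd * ‖V x‖ ^ 2) (4 / 3) (volume.restrict (Ω : Set E)) :=
      (hN43.norm.const_mul Cσ).add ((hVsq2.mono_exponent h43two).const_mul Cd)
    refine MemLp.of_le_mul (c := 1) hm hΘmeas (Eventually.of_forall fun x => ?_)
    rw [one_mul, Real.norm_of_nonneg (by positivity)]
    calc ‖σ x • N x + (fderiv ℝ σ x).smulRight (‖V x‖ ^ 2)‖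
        ≤ ‖σ x • N x‖ + ‖(fderiv ℝ σ x).smulRight (‖V x‖ ^ 2)‖ := norm_add_le _ _
      _ ≤ Cσ * ‖N x‖ + Cd * ‖V x‖ ^ 2 := by
          refine add_le_add ?_ ?_
          · rw [norm_smul]; gcongr; exact hCσ x
          · refine (norm_smulRight_le_mul _ _).trans ?_
            rw [Real.norm_of_nonneg (sq_nonneg _)]
            gcongr; exact hCd x
  -- divergence-free testing of `θ`
  have key := hdiv.integral_weakGradient_apply_eq_zero holderTriple_four_fourThirds_one h43one h43top
    hV4 hθc hΘ hΘ43
  -- evaluate `Θ(V)` pointwise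
  have hΘV : ∀ x, Θ x (V x) =
      2 * (σ x * ⟪V x, G x (V x)⟫) + ‖V x‖ ^ 2 * ⟪V x, gradient σ x⟫ := by
    intro x
    rw [real_inner_comm (gradient σ x) (V x), inner_gradient_left]
    by_cases hx : x ∈ (Ω : Set E)
    · rw [hΘ_def, indicator_of_mem hx]
      simp [hN_def]
      ring
    · have hxσ : x ∉ tsupport σ := fun h => hx (hR h)
      rw [hΘ_def, indicator_of_notMem hx, image_eq_zero_of_notMem_tsupport hxσ,
        fderiv_of_notMem_tsupport (𝕜 := ℝ) hxσ]
      simp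
  -- integrability of the two terms (products of `L²` functions supported in the ball)
  have hA1 : MemLp ((Ω : Set E).indicator fun x => ‖V x‖) 2 volume :=
    (memLp_indicator_iff_restrict hΩm).2 hV2Ω.norm
  have hA2 : MemLp ((Ω : Set E).indicator fun x => ‖V x‖ ^ 2) 2 volume :=
    (memLp_indicator_iff_restrict hΩm).2 hVsq2
  have hB : MemLp ((Ω : Set E).indicator fun x => ‖G x‖) 2 volume :=
    (memLp_indicator_iff_restrict hΩm).2 hGL2.norm
  have hgradc : Continuous (gradient σ) :=
    (InnerProductSpace.toDual ℝ E).symm.continuous.comp (hσ.contDiff.continuous_fderiv (by simp))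
  have hI1 : Integrable (fun x => σ x * ⟪V x, G x (V x)⟫) volume := by
    have hprod2 := (MemLp.integrable_mul hA2 hB).const_mul Cσ
    refine hprod2.mono' (hσ.contDiff.continuous.aestronglyMeasurable.mul
      (hVm.inner (aestronglyMeasurable_clm_apply_field hGm0 hVm))) (Eventually.of_forall fun x => ?_)
    by_cases hx : x ∈ (Ω : Set E)
    · simp only [Pi.mul_apply, indicator_of_mem hx, norm_mul, Real.norm_eq_abs]
      calc |σ x| * |⟪V x, G x (V x)⟫| ≤ Cσ * (‖V x‖ * (‖G x‖ * ‖V x‖)) := by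
            gcongr
            · simpa [Real.norm_eq_abs] using hCσ x
            · exact (abs_real_inner_le_norm _ _).trans (by gcongr; exact (G x).le_opNorm (V x))
        _ = Cσ * (‖V x‖ ^ 2 * ‖G x‖) := by ring
    · have hxσ : x ∉ tsupport σ := fun h => hx (hR h)
      simp [indicator_of_notMem hx, image_eq_zero_of_notMem_tsupport hxσ]
  have hI2 : Integrable (fun x => ‖V x‖ ^ 2 * ⟪V x, gradient σ x⟫) volume := by
    have hprod2 := (MemLp.integrable_mul hA2 hA1).const_mul Cd
    refine hprod2.mono' ((hVm.norm.pow 2).mul (hVm.inner hgradc.aestronglyMeasurable))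
      (Eventually.of_forall fun x => ?_)
    rw [real_inner_comm (gradient σ x) (V x), inner_gradient_left]
    by_cases hx : x ∈ (Ω : Set E)
    · simp only [Pi.mul_apply, indicator_of_mem hx, norm_mul, Real.norm_eq_abs, abs_pow, abs_norm]
      calc ‖V x‖ ^ 2 * |fderiv ℝ σ x (V x)| ≤ ‖V x‖ ^ 2 * (Cd * ‖V x‖) := by
            gcongr
            exact (Real.norm_eq_abs _ ▸ (fderiv ℝ σ x).le_opNorm (V x)).trans
              (by gcongr; exact hCd x)
        _ = Cd * (‖V x‖ ^ 2 * ‖V x‖) := by ring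
    · have hxσ : x ∉ tsupport σ := fun h => hx (hR h)
      simp [indicator_of_notMem hx, fderiv_of_notMem_tsupport (𝕜 := ℝ) hxσ]
  -- conclude
  have hsum : 2 * (∫ x, σ x * ⟪V x, G x (V x)⟫) + ∫ x, ‖V x‖ ^ 2 * ⟪V x, gradient σ x⟫ = 0 := by
    have h0 := key
    simp_rw [hΘV] at h0
    rw [integral_add (hI1.const_mul 2) hI2, integral_const_mul] at h0
    exact h0
  linarith

end Cubic


/-! ### The two-sided local energy identity -/

section Energy

open scoped Pointwise

variable {V F : E → E} {P : E → ℝ} {G : E → E →L[ℝ] E}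

omit [FiniteDimensional ℝ E] [MeasurableSpace E] [BorelSpace E] in
/-- `‖c.smulRight w‖ ≤ ‖c‖ ‖w‖` for a functional `c` and a vector `w`. [folklore] -/
private theorem norm_smulRight_le_mul' {F' : Type*} [NormedAddCommGroup F'] [NormedSpace ℝ F']
    (c : E →L[ℝ] ℝ) (w : F') : ‖c.smulRight w‖ ≤ ‖c‖ * ‖w‖ := by
  refine ContinuousLinearMap.opNorm_le_bound _ (by positivity) fun v => ?_
  rw [ContinuousLinearMap.smulRight_apply, norm_smul, mul_right_comm]
  gcongr
  exact c.le_opNorm v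

omit [MeasurableSpace E] [BorelSpace E] in
/-- The trace of the rank-one map `v ↦ c(v) • w` is `c(w)`. [folklore] -/
private theorem trace_smulRight (c : E →L[ℝ] ℝ) (w : E) :
    LinearMap.trace ℝ E ((c.smulRight w : E →L[ℝ] E) : E →ₗ[ℝ] E) = c w := by
  rw [LinearMap.trace_eq_sum_inner _ (stdOrthonormalBasis ℝ E),
    clm_apply_eq_sum_inner_smul_stdBasis c w]
  refine Finset.sum_congr rfl fun i _ => ?_
  simp only [ContinuousLinearMap.coe_coe, ContinuousLinearMap.smulRight_apply, inner_smul_right,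
    smul_eq_mul, mul_comm]

/-- `σ • V ∈ L²` for a test function `σ` and `V ∈ L²` on a ball containing `tsupport σ`.
[folklore] -/
private theorem memLp_testFunction_smul {σ : E → ℝ} (hσ : IsTestFunctionOn (⊤ : Opens E) σ) {R : ℝ}
    (hR : tsupport σ ⊆ ball (0 : E) R) {p : ℝ≥0∞} (hVm : AEStronglyMeasurable V volume)
    (hVp : MemLp V p (volume.restrict (ball (0 : E) R))) :
    MemLp (fun x => σ x • V x) p volume := by
  obtain ⟨Cσ, hCσ⟩ := hσ.contDiff.continuous.bounded_above_of_compact_support hσ.hasCompactSupport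
  have hA : MemLp ((ball (0 : E) R).indicator V) p volume :=
    (memLp_indicator_iff_restrict measurableSet_ball).2 hVp
  refine MemLp.of_le_mul (c := Cσ) hA (hσ.contDiff.continuous.aestronglyMeasurable.smul hVm)
    (Eventually.of_forall fun x => ?_)
  by_cases hx : x ∈ ball (0 : E) R
  · rw [indicator_of_mem hx, norm_smul]; gcongr; exact hCσ x
  · have : σ x = 0 := image_eq_zero_of_notMem_tsupport fun h => hx (hR h)
    simp [this, indicator_of_notMem hx]

/-- The weak gradient `Dσ ⊗ V + σ G` of `σ • V` lies in `L²` when `V, G ∈ L²` on a ball containing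
`tsupport σ`. [folklore] -/
private theorem memLp_two_weakGradient_cutoff_smul {σ : E → ℝ} (hσ : IsTestFunctionOn (⊤ : Opens E) σ)
    {R : ℝ} (hR : tsupport σ ⊆ ball (0 : E) R) (hG : HasWeakGradient V G)
    (hV2 : MemLp V 2 (volume.restrict (ball (0 : E) R)))
    (hG2 : ∀ v : E, MemLp (fun x => G x v) 2 (volume.restrict (ball (0 : E) R))) :
    MemLp (fun x => (fderiv ℝ σ x).smulRight (V x) + σ x • G x) 2 volume := by
  obtain ⟨Cσ, hCσ⟩ := hσ.contDiff.continuous.bounded_above_of_compact_support hσ.hasCompactSupport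
  obtain ⟨Cd, hCd⟩ := (hσ.contDiff.continuous_fderiv (by simp)).bounded_above_of_compact_support
    (hσ.hasCompactSupport.fderiv ℝ)
  have hCσ0 : 0 ≤ Cσ := (norm_nonneg _).trans (hCσ 0)
  have hCd0 : 0 ≤ Cd := (norm_nonneg _).trans (hCd 0)
  have hΨ : HasWeakGradient (fun x => σ x • V x) (fun x => (fderiv ℝ σ x).smulRight (V x) + σ x • G x) :=
    hG.smul_contDiff hσ.contDiff
  have hΨm : AEStronglyMeasurable (fun x => (fderiv ℝ σ x).smulRight (V x) + σ x • G x) volume := by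
    have := hΨ.locallyIntegrableOn_deriv.aestronglyMeasurable
    simpa only [Opens.coe_top, Measure.restrict_univ] using this
  have hGm : AEStronglyMeasurable G (volume.restrict (ball (0 : E) R)) := by
    have := hG.locallyIntegrableOn_deriv.aestronglyMeasurable
    simp only [Opens.coe_top, Measure.restrict_univ] at this
    exact this.restrict
  have hGL2 : MemLp G 2 (volume.restrict (ball (0 : E) R)) :=
    memLp_two_of_forall_apply (Ω := ⟨ball (0 : E) R, isOpen_ball⟩) hGm hG2
  have hA : MemLp ((ball (0 : E) R).indicator fun x => ‖V x‖) 2 volume :=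
    (memLp_indicator_iff_restrict measurableSet_ball).2 hV2.norm
  have hB : MemLp ((ball (0 : E) R).indicator fun x => ‖G x‖) 2 volume :=
    (memLp_indicator_iff_restrict measurableSet_ball).2 hGL2.norm
  have hm : MemLp (fun x => Cd * (ball (0 : E) R).indicator (fun x => ‖V x‖) x +
      Cσ * (ball (0 : E) R).indicator (fun x => ‖G x‖) x) 2 volume :=
    (hA.const_mul Cd).add (hB.const_mul Cσ)
  refine MemLp.of_le_mul (c := 1) hm hΨm (Eventually.of_forall fun x => ?_)
  by_cases hx : x ∈ ball (0 : E) R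
  · simp only [indicator_of_mem hx, one_mul]
    calc ‖(fderiv ℝ σ x).smulRight (V x) + σ x • G x‖
        ≤ ‖(fderiv ℝ σ x).smulRight (V x)‖ + ‖σ x • G x‖ := norm_add_le _ _
      _ ≤ Cd * ‖V x‖ + Cσ * ‖G x‖ := by
          refine add_le_add ((norm_smulRight_le_mul' _ _).trans ?_) ?_
          · gcongr; exact hCd x
          · rw [norm_smul]; gcongr; exact hCσ x
      _ ≤ ‖Cd * ‖V x‖ + Cσ * ‖G x‖‖ := le_abs_self _
  · have hxσ : x ∉ tsupport σ := fun h => hx (hR h)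
    simp [indicator_of_notMem hx, image_eq_zero_of_notMem_tsupport hxσ,
      fderiv_of_notMem_tsupport (𝕜 := ℝ) hxσ]

/-- `‖V‖² ⟪V, ∇σ⟫ ∈ L¹` for `V ∈ L⁴` on a ball containing `tsupport σ`. [folklore] -/
private theorem integrable_norm_sq_mul_inner_gradient {σ : E → ℝ} (hσ : IsTestFunctionOn (⊤ : Opens E) σ)
    {R : ℝ} (hR : tsupport σ ⊆ ball (0 : E) R) (hVm : AEStronglyMeasurable V volume)
    (hV4 : MemLp V 4 (volume.restrict (ball (0 : E) R))) :
    Integrable (fun x => ‖V x‖ ^ 2 * ⟪V x, gradient σ x⟫) volume := by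
  obtain ⟨Cd, hCd⟩ := (hσ.contDiff.continuous_fderiv (by simp)).bounded_above_of_compact_support
    (hσ.hasCompactSupport.fderiv ℝ)
  haveI : IsFiniteMeasure (volume.restrict (ball (0 : E) R)) :=
    isFiniteMeasure_restrict.2 measure_ball_lt_top.ne
  have hA1 : MemLp ((ball (0 : E) R).indicator fun x => ‖V x‖) 2 volume :=
    (memLp_indicator_iff_restrict measurableSet_ball).2 (hV4.mono_exponent (by norm_num)).norm
  have hA2 : MemLp ((ball (0 : E) R).indicator fun x => ‖V x‖ ^ 2) 2 volume :=
    (memLp_indicator_iff_restrict measurableSet_ball).2 (memLp_two_norm_sq_of_memLp_four hV4)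
  have hgradc : Continuous (gradient σ) :=
    (InnerProductSpace.toDual ℝ E).symm.continuous.comp (hσ.contDiff.continuous_fderiv (by simp))
  refine ((MemLp.integrable_mul hA2 hA1).const_mul Cd).mono'
    ((hVm.norm.pow 2).mul (hVm.inner hgradc.aestronglyMeasurable)) (Eventually.of_forall fun x => ?_)
  rw [real_inner_comm (gradient σ x) (V x), inner_gradient_left]
  by_cases hx : x ∈ ball (0 : E) R
  · simp only [Pi.mul_apply, indicator_of_mem hx, norm_mul, Real.norm_eq_abs, abs_pow, abs_norm]
    calc ‖V x‖ ^ 2 * |fderiv ℝ σ x (V x)| ≤ ‖V x‖ ^ 2 * (Cd * ‖V x‖) := by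
          gcongr
          exact (Real.norm_eq_abs _ ▸ (fderiv ℝ σ x).le_opNorm (V x)).trans (by gcongr; exact hCd x)
      _ = Cd * (‖V x‖ ^ 2 * ‖V x‖) := by ring
  · have hxσ : x ∉ tsupport σ := fun h => hx (hR h)
    simp [indicator_of_notMem hx, fderiv_of_notMem_tsupport (𝕜 := ℝ) hxσ]

/-- `P ⟪V, ∇σ⟫ ∈ L¹` for `P ∈ L^{3/2}`, `V ∈ L³` on a ball containing `tsupport σ`. [folklore] -/
private theorem integrable_pressure_mul_inner_gradient {σ : E → ℝ} (hσ : IsTestFunctionOn (⊤ : Opens E) σ)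
    {R : ℝ} (hR : tsupport σ ⊆ ball (0 : E) R) (hVm : AEStronglyMeasurable V volume)
    (hPm : AEStronglyMeasurable P volume) (hV3 : MemLp V 3 (volume.restrict (ball (0 : E) R)))
    (hP : MemLp P (3 / 2) (volume.restrict (ball (0 : E) R))) :
    Integrable (fun x => P x * ⟪V x, gradient σ x⟫) volume := by
  obtain ⟨Cd, hCd⟩ := (hσ.contDiff.continuous_fderiv (by simp)).bounded_above_of_compact_support
    (hσ.hasCompactSupport.fderiv ℝ)
  have hA : MemLp ((ball (0 : E) R).indicator fun x => ‖V x‖) 3 volume :=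
    (memLp_indicator_iff_restrict measurableSet_ball).2 hV3.norm
  have hB : MemLp ((ball (0 : E) R).indicator fun x => ‖P x‖) (3 / 2) volume :=
    (memLp_indicator_iff_restrict measurableSet_ball).2 hP.norm
  have hgradc : Continuous (gradient σ) :=
    (InnerProductSpace.toDual ℝ E).symm.continuous.comp (hσ.contDiff.continuous_fderiv (by simp))
  haveI : ENNReal.HolderTriple (3 / 2) 3 1 := ENNReal.HolderTriple.symm (hpqr := holderTriple_three_threeHalves)
  have hprod : Integrable (((ball (0 : E) R).indicator fun x => ‖P x‖) *
      (ball (0 : E) R).indicator fun x => ‖V x‖) volume :=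
    MemLp.integrable_mul hB hA
  refine (hprod.const_mul Cd).mono' (hPm.mul (hVm.inner hgradc.aestronglyMeasurable))
    (Eventually.of_forall fun x => ?_)
  rw [real_inner_comm (gradient σ x) (V x), inner_gradient_left]
  by_cases hx : x ∈ ball (0 : E) R
  · simp only [Pi.mul_apply, indicator_of_mem hx, norm_mul, Real.norm_eq_abs]
    calc |P x| * |fderiv ℝ σ x (V x)| ≤ |P x| * (Cd * ‖V x‖) := by
          gcongr
          exact (Real.norm_eq_abs _ ▸ (fderiv ℝ σ x).le_opNorm (V x)).trans (by gcongr; exact hCd x)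
      _ = Cd * (|P x| * ‖V x‖) := by ring
  · have hxσ : x ∉ tsupport σ := fun h => hx (hR h)
    simp [indicator_of_notMem hx, fderiv_of_notMem_tsupport (𝕜 := ℝ) hxσ]

/-- **The two-sided local energy identity for steady weak Euler-type systems** (Sohr 2001,
(III.3.7.10)–(III.3.7.13): the velocity is an admissible test field for `∇v ∈ L²` in dimension
`≤ 4`, there `v ∈ W^{1,2}_{0,σ}`; Chae–Shvydkoy 2013, §2.2: the local energy equality as the
starting point (2.9)).  Let `V ∈ L⁴_loc` be weakly divergence free with whole-space weak
gradient `G ∈ L²_loc`, `P ∈ L^{3/2}_loc`, `F ∈ L²_loc`, and let the steady weak Euler identity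
with forcing hold: `∫ (⟪F, ψ⟫ + ⟪V, Dψ(V)⟫ + P div ψ) = 0` for all `ψ ∈ C_c^∞(E; E)` (weak form
of `(V·∇)V + ∇P = F`).  Then for every real test function `σ`:
`∫ σ ⟪F, V⟫ + ∫ (‖V‖²/2 + P) ⟪V, ∇σ⟫ = 0`.
Proof: `ψ = σV` is admissible by `steadyEuler_test_of_weakGradient` (weak gradient `Dσ ⊗ V + σG`,
trace `⟪V, ∇σ⟫` since `tr G = 0` a.e.), and the cubic term is
`∫ ⟪V,∇σ⟫‖V‖² + ∫ σ⟪V, G V⟫ = ½ ∫ ‖V‖²⟪V, ∇σ⟫` (`integral_mul_inner_weakGradient_self`).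
[cite: Sohr2001, Ch. III (3.7.10)–(3.7.13); ChaeShvydkoy2013 §2.2 (2.9)] -/
theorem steadyEuler_localEnergyIdentity
    (hV4 : ∀ r : ℝ, MemLp V 4 (volume.restrict (ball (0 : E) r)))
    (hG : HasWeakGradient V G)
    (hG2 : ∀ (r : ℝ) (v : E), MemLp (fun x => G x v) 2 (volume.restrict (ball (0 : E) r)))
    (hdiv : IsWeaklyDivFree V)
    (hP : ∀ r : ℝ, MemLp P (3 / 2) (volume.restrict (ball (0 : E) r)))
    (hF : ∀ r : ℝ, MemLp F 2 (volume.restrict (ball (0 : E) r)))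
    (hEq : ∀ ψ : E → E, IsTestFunctionOn (⊤ : Opens E) ψ →
      ∫ x, (⟪F x, ψ x⟫ + ⟪V x, fderiv ℝ ψ x (V x)⟫ + P x * VectorCalculus.divergence ψ x) = 0)
    {σ : E → ℝ} (hσ : IsTestFunctionOn (⊤ : Opens E) σ) :
    (∫ x, σ x * ⟪F x, V x⟫) + ∫ x, (‖V x‖ ^ 2 / 2 + P x) * ⟪V x, gradient σ x⟫ = 0 := by
  -- a ball containing the support of `σ`
  obtain ⟨R, -, hR⟩ := hσ.hasCompactSupport.isCompact.isBounded.subset_ball_lt 0 0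
  haveI : IsFiniteMeasure (volume.restrict (ball (0 : E) R)) :=
    isFiniteMeasure_restrict.2 measure_ball_lt_top.ne
  have hVm : AEStronglyMeasurable V volume := by
    have := hG.locallyIntegrableOn.aestronglyMeasurable
    simpa only [Opens.coe_top, Measure.restrict_univ] using this
  have hPm : AEStronglyMeasurable P volume :=
    aestronglyMeasurable_of_forall_ball fun n => (hP n).1
  have hV2R : MemLp V 2 (volume.restrict (ball (0 : E) R)) := (hV4 R).mono_exponent (by norm_num)
  have hV3R : MemLp V 3 (volume.restrict (ball (0 : E) R)) := (hV4 R).mono_exponent (by norm_num)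
  -- the test field `ψ = σ V` and its weak gradient
  set ψ : E → E := fun x => σ x • V x with hψ_def
  set Ψ : E → E →L[ℝ] E := fun x => (fderiv ℝ σ x).smulRight (V x) + σ x • G x with hΨ_def
  have hψc : HasCompactSupport ψ := hσ.hasCompactSupport.smul_right
  have hψ2 : MemLp ψ 2 volume := memLp_testFunction_smul hσ hR hVm hV2R
  have hΨ : HasWeakGradient ψ Ψ := hG.smul_contDiff hσ.contDiff
  have hΨ2 : MemLp Ψ 2 volume := memLp_two_weakGradient_cutoff_smul hσ hR hG hV2R (hG2 R)
  -- the trace of `Ψ` is `⟪V, ∇σ⟫` a.e.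
  have htr0 := hdiv.trace_weakGradient_ae_eq_zero hG
  have htrΨ : (fun x => LinearMap.trace ℝ E (Ψ x : E →ₗ[ℝ] E)) =ᵐ[volume]
      fun x => ⟪V x, gradient σ x⟫ := by
    filter_upwards [htr0] with x hx
    rw [hΨ_def, real_inner_comm (gradient σ x) (V x), inner_gradient_left]
    simp [hx]
  have hgradc : Continuous (gradient σ) :=
    (InnerProductSpace.toDual ℝ E).symm.continuous.comp (hσ.contDiff.continuous_fderiv (by simp))
  have hΨ3 : MemLp (fun x => LinearMap.trace ℝ E (Ψ x : E →ₗ[ℝ] E)) 3 volume := by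
    refine MemLp.ae_eq htrΨ.symm ?_
    obtain ⟨Cd, hCd⟩ := (hσ.contDiff.continuous_fderiv (by simp)).bounded_above_of_compact_support
      (hσ.hasCompactSupport.fderiv ℝ)
    have hA : MemLp ((ball (0 : E) R).indicator fun x => ‖V x‖) 3 volume :=
      (memLp_indicator_iff_restrict measurableSet_ball).2 hV3R.norm
    refine MemLp.of_le_mul (c := Cd) hA (hVm.inner hgradc.aestronglyMeasurable)
      (Eventually.of_forall fun x => ?_)
    rw [real_inner_comm (gradient σ x) (V x), inner_gradient_left]
    by_cases hx : x ∈ ball (0 : E) R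
    · rw [indicator_of_mem hx, Real.norm_of_nonneg (norm_nonneg _)]
      exact ((fderiv ℝ σ x).le_opNorm (V x)).trans (by gcongr; exact hCd x)
    · have hxσ : x ∉ tsupport σ := fun h => hx (hR h)
      simp [indicator_of_notMem hx, fderiv_of_notMem_tsupport (𝕜 := ℝ) hxσ]
  -- the momentum identity tested with `ψ`
  have hT := steadyEuler_test_of_weakGradient hV4 hP hF hEq hψc hψ2 hΨ hΨ2 hΨ3
  -- evaluate the three terms
  have e1 : (∫ x, ⟪F x, ψ x⟫) = ∫ x, σ x * ⟪F x, V x⟫ :=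
    integral_congr_ae (Eventually.of_forall fun x => by simp [hψ_def, inner_smul_right])
  have hI1 := integrable_norm_sq_mul_inner_gradient hσ hR hVm (hV4 R)
  have hI2 : Integrable (fun x => σ x * ⟪V x, G x (V x)⟫) volume := by
    -- `σ ⟪V, G V⟫ = ⟪V, Ψ V⟫ - ‖V‖²⟪V, ∇σ⟫`, both integrable? use the bound directly
    obtain ⟨Cσ, hCσ⟩ := hσ.contDiff.continuous.bounded_above_of_compact_support hσ.hasCompactSupport
    have hCσ0 : 0 ≤ Cσ := (norm_nonneg _).trans (hCσ 0)
    have hGm : AEStronglyMeasurable G volume := by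
      have := hG.locallyIntegrableOn_deriv.aestronglyMeasurable
      simpa only [Opens.coe_top, Measure.restrict_univ] using this
    have hGL2 : MemLp G 2 (volume.restrict (ball (0 : E) R)) :=
      memLp_two_of_forall_apply (Ω := ⟨ball (0 : E) R, isOpen_ball⟩) hGm.restrict (hG2 R)
    have hA2 : MemLp ((ball (0 : E) R).indicator fun x => ‖V x‖ ^ 2) 2 volume :=
      (memLp_indicator_iff_restrict measurableSet_ball).2 (memLp_two_norm_sq_of_memLp_four (hV4 R))
    have hB : MemLp ((ball (0 : E) R).indicator fun x => ‖G x‖) 2 volume :=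
      (memLp_indicator_iff_restrict measurableSet_ball).2 hGL2.norm
    refine ((MemLp.integrable_mul hA2 hB).const_mul Cσ).mono'
      (hσ.contDiff.continuous.aestronglyMeasurable.mul (hVm.inner (aestronglyMeasurable_clm_apply_field hGm hVm)))
      (Eventually.of_forall fun x => ?_)
    by_cases hx : x ∈ ball (0 : E) R
    · simp only [Pi.mul_apply, indicator_of_mem hx, norm_mul, Real.norm_eq_abs]
      calc |σ x| * |⟪V x, G x (V x)⟫| ≤ Cσ * (‖V x‖ * (‖G x‖ * ‖V x‖)) := by
            gcongr
            · simpa [Real.norm_eq_abs] using hCσ x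
            · exact (abs_real_inner_le_norm _ _).trans (by gcongr; exact (G x).le_opNorm (V x))
        _ = Cσ * (‖V x‖ ^ 2 * ‖G x‖) := by ring
    · have hxσ : x ∉ tsupport σ := fun h => hx (hR h)
      simp [indicator_of_notMem hx, image_eq_zero_of_notMem_tsupport hxσ]
  have e2 : (∫ x, ⟪V x, Ψ x (V x)⟫) =
      (∫ x, ‖V x‖ ^ 2 * ⟪V x, gradient σ x⟫) + ∫ x, σ x * ⟪V x, G x (V x)⟫ := by
    rw [← integral_add hI1 hI2]
    refine integral_congr_ae (Eventually.of_forall fun x => ?_)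
    show ⟪V x, Ψ x (V x)⟫ = ‖V x‖ ^ 2 * ⟪V x, gradient σ x⟫ + σ x * ⟪V x, G x (V x)⟫
    rw [hΨ_def, real_inner_comm (gradient σ x) (V x), inner_gradient_left]
    simp [inner_add_right, inner_smul_right]
    ring
  have e3 : (∫ x, P x * LinearMap.trace ℝ E (Ψ x : E →ₗ[ℝ] E)) = ∫ x, P x * ⟪V x, gradient σ x⟫ := by
    refine integral_congr_ae ?_
    filter_upwards [htrΨ] with x hx
    rw [hx]
  have hkey := hdiv.integral_mul_inner_weakGradient_self hV4 hG hG2 hσ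
  have hI3 := integrable_pressure_mul_inner_gradient hσ hR hVm hPm hV3R (hP R)
  have e4 : (∫ x, (‖V x‖ ^ 2 / 2 + P x) * ⟪V x, gradient σ x⟫) =
      (1 / 2) * (∫ x, ‖V x‖ ^ 2 * ⟪V x, gradient σ x⟫) + ∫ x, P x * ⟪V x, gradient σ x⟫ := by
    rw [← integral_const_mul, ← integral_add (hI1.const_mul _) hI3]
    refine integral_congr_ae (Eventually.of_forall fun x => ?_)
    ring
  rw [e1, e2, e3] at hT
  rw [e4]
  linarith

end Energy


/-! ### The linear self-similar term and the profile energy identity -/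

section SelfSimilar

variable {V : E → E} {P : E → ℝ} {G : E → E →L[ℝ] E}

/-- **The linear self-similar term** `⟪(x·∇)V, V⟫ = ½ x·∇‖V‖²` integrated against a cutoff:
for `V ∈ L²_loc` with whole-space weak gradient `G ∈ L²_loc` and a real test function `σ`,
`∫ σ(x) ⟪G(x) x, V(x)⟫ dx = -½ ∫ ‖V‖² (dim E · σ + ⟪x, ∇σ⟫)`
(the weak chain rule `D‖V‖² = 2⟨V, DV⟩` tested with the test functions `σ(x)⟪bᵢ, x⟫` and summed
over an orthonormal basis; `div (σ x) = dim E · σ + x·∇σ`).  This is the weak form of the term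
`(1/(1+α)) y·∇v` of the self-similar Euler profile equation (Chae–Shvydkoy 2013, (2.1)) in the
energy balance. [cite: ChaeShvydkoy2013, (2.1) and §2.2] -/
theorem integral_mul_inner_weakGradient_apply_id
    (hV2 : ∀ r : ℝ, MemLp V 2 (volume.restrict (ball (0 : E) r))) (hG : HasWeakGradient V G)
    (hG2 : ∀ (r : ℝ) (v : E), MemLp (fun x => G x v) 2 (volume.restrict (ball (0 : E) r)))
    {σ : E → ℝ} (hσ : IsTestFunctionOn (⊤ : Opens E) σ) :
    ∫ x, σ x * ⟪G x x, V x⟫ =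
      -(1 / 2) * ∫ x, ‖V x‖ ^ 2 * ((Module.finrank ℝ E : ℝ) * σ x + ⟪x, gradient σ x⟫) := by
  -- a ball containing the support of `σ`, the data on it
  obtain ⟨R, -, hR⟩ := hσ.hasCompactSupport.isCompact.isBounded.subset_ball_lt 0 0
  set Ω : Opens E := ⟨ball (0 : E) R, isOpen_ball⟩ with hΩ
  have hΩm : MeasurableSet (Ω : Set E) := measurableSet_ball
  haveI : IsFiniteMeasure (volume.restrict (Ω : Set E)) :=
    isFiniteMeasure_restrict.2 measure_ball_lt_top.ne
  have hVm : AEStronglyMeasurable V volume := by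
    have := hG.locallyIntegrableOn.aestronglyMeasurable
    simpa only [Opens.coe_top, Measure.restrict_univ] using this
  have hGm0 : AEStronglyMeasurable G volume := by
    have := hG.locallyIntegrableOn_deriv.aestronglyMeasurable
    simpa only [Opens.coe_top, Measure.restrict_univ] using this
  have hV2Ω : MemLp V 2 (volume.restrict (Ω : Set E)) := hV2 R
  have hGΩ : HasWeakFDerivOn Ω volume V G := HasWeakFDerivOn.mono_set_holds hG le_top
  have hG2Ω : ∀ v, MemLp (fun x => G x v) 2 (volume.restrict (Ω : Set E)) := fun v => hG2 R v
  have hGL2 : MemLp G 2 (volume.restrict (Ω : Set E)) := memLp_two_of_forall_apply hGm0.restrict hG2Ω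
  have hN : HasWeakFDerivOn Ω volume (fun x => ‖V x‖ ^ 2)
      (fun x => (2 : ℝ) • (innerSL ℝ (V x)).comp (G x)) := hasWeakFDerivOn_norm_sq hV2Ω hGΩ hG2Ω
  set b := stdOrthonormalBasis ℝ E with hb
  -- bounds on `σ`, `Dσ` and `‖x‖` on the ball
  obtain ⟨Cσ, hCσ⟩ := hσ.contDiff.continuous.bounded_above_of_compact_support hσ.hasCompactSupport
  obtain ⟨Cd, hCd⟩ := (hσ.contDiff.continuous_fderiv (by simp)).bounded_above_of_compact_support
    (hσ.hasCompactSupport.fderiv ℝ)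
  -- the test functions `φᵢ = σ ⟪bᵢ, ·⟫` on `Ω`
  have hlin : ∀ i, ContDiff ℝ ∞ fun x : E => ⟪b i, x⟫ := fun i => (innerSL ℝ (b i)).contDiff
  have hφ : ∀ i, IsTestFunctionOn Ω fun x => σ x * ⟪b i, x⟫ := fun i =>
    { contDiff := hσ.contDiff.mul (hlin i)
      hasCompactSupport := hσ.hasCompactSupport.mul_right
      tsupport_subset := (tsupport_mul_subset_left (f := σ)).trans hR }
  have hdφ : ∀ i x, fderiv ℝ (fun x => σ x * ⟪b i, x⟫) x (b i) =
      fderiv ℝ σ x (b i) * ⟪b i, x⟫ + σ x := by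
    intro i x
    have h1 : DifferentiableAt ℝ σ x := (hσ.contDiff.differentiable (by simp)) x
    have h2 : DifferentiableAt ℝ (fun x : E => ⟪b i, x⟫) x := ((hlin i).differentiable (by simp)) x
    have hfd : fderiv ℝ (fun x : E => ⟪b i, x⟫) x = innerSL ℝ (b i) := by
      have : (fun x : E => ⟪b i, x⟫) = ⇑(innerSL ℝ (b i)) := by funext y; simp
      rw [this]; exact (innerSL ℝ (b i)).fderiv
    rw [fderiv_fun_mul h1 h2, hfd]
    simp only [_root_.add_apply, _root_.smul_apply, smul_eq_mul,
      innerSL_apply_apply, real_inner_self_eq_norm_sq, b.orthonormal.1 i, one_pow, mul_one]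
    ring
  -- the tested identities, as whole-space integrals
  have hid : ∀ i, ∫ x, (fderiv ℝ σ x (b i) * ⟪b i, x⟫ + σ x) * ‖V x‖ ^ 2 =
      -∫ x, (σ x * ⟪b i, x⟫) * (2 * ⟪V x, G x (b i)⟫) := by
    intro i
    have key := hN.integral_fderiv_smul_eq _ (b i) (hφ i)
    simp only [smul_eq_mul, hdφ i] at key
    have e1 : ∫ x in (Ω : Set E), (fderiv ℝ σ x (b i) * ⟪b i, x⟫ + σ x) * ‖V x‖ ^ 2 =
        ∫ x, (fderiv ℝ σ x (b i) * ⟪b i, x⟫ + σ x) * ‖V x‖ ^ 2 := by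
      refine setIntegral_eq_integral_of_forall_compl_eq_zero fun x hx => ?_
      have hxσ : x ∉ tsupport σ := fun h => hx (hR h)
      simp [image_eq_zero_of_notMem_tsupport hxσ, fderiv_of_notMem_tsupport (𝕜 := ℝ) hxσ]
    have e2 : ∫ x in (Ω : Set E), (σ x * ⟪b i, x⟫) * ((2 : ℝ) • (innerSL ℝ (V x)).comp (G x)) (b i) =
        ∫ x, (σ x * ⟪b i, x⟫) * (2 * ⟪V x, G x (b i)⟫) := by
      rw [setIntegral_eq_integral_of_forall_compl_eq_zero fun x hx => ?_]
      · refine integral_congr_ae (Eventually.of_forall fun x => ?_)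
        simp
      · have hxσ : x ∉ tsupport σ := fun h => hx (hR h)
        simp [image_eq_zero_of_notMem_tsupport hxσ]
    rw [← e1, key, e2]
  -- integrability (everything is supported in the ball)
  have hA2 : MemLp ((Ω : Set E).indicator fun x => ‖V x‖ ^ 2) 1 volume :=
    (memLp_indicator_iff_restrict hΩm).2 ((memLp_two_iff_integrable_sq_norm hV2Ω.1).1 hV2Ω |>
      memLp_one_iff_integrable.2)
  have hVsqI : Integrable ((Ω : Set E).indicator fun x => ‖V x‖ ^ 2) volume :=
    memLp_one_iff_integrable.1 hA2
  have hA : MemLp ((Ω : Set E).indicator fun x => ‖V x‖) 2 volume :=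
    (memLp_indicator_iff_restrict hΩm).2 hV2Ω.norm
  have hB : MemLp ((Ω : Set E).indicator fun x => ‖G x‖) 2 volume :=
    (memLp_indicator_iff_restrict hΩm).2 hGL2.norm
  have hVGI : Integrable (((Ω : Set E).indicator fun x => ‖V x‖) * (Ω : Set E).indicator fun x => ‖G x‖)
      volume := MemLp.integrable_mul hA hB
  have hIL : ∀ i, Integrable (fun x => (fderiv ℝ σ x (b i) * ⟪b i, x⟫ + σ x) * ‖V x‖ ^ 2) volume := by
    intro i
    refine (hVsqI.const_mul (Cd * R + Cσ)).mono'
      ((((hσ.contDiff.continuous_fderiv (by simp)).clm_apply continuous_const).mul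
        (hlin i).continuous |>.add hσ.contDiff.continuous).aestronglyMeasurable.mul (hVm.norm.pow 2))
      (Eventually.of_forall fun x => ?_)
    by_cases hx : x ∈ (Ω : Set E)
    · have hxR : ‖x‖ ≤ R := (mem_ball_zero_iff.1 hx).le
      simp only [indicator_of_mem hx, norm_mul, Real.norm_eq_abs, abs_pow, abs_norm]
      gcongr
      calc |fderiv ℝ σ x (b i) * ⟪b i, x⟫ + σ x| ≤ |fderiv ℝ σ x (b i) * ⟪b i, x⟫| + |σ x| :=
            abs_add_le _ _
        _ ≤ Cd * R + Cσ := by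
            refine add_le_add ?_ (by simpa [Real.norm_eq_abs] using hCσ x)
            rw [abs_mul]
            calc |fderiv ℝ σ x (b i)| * |⟪b i, x⟫| ≤ Cd * (‖b i‖ * ‖x‖) := by
                  gcongr
                  · exact (norm_nonneg _).trans (hCd x)
                  · exact (Real.norm_eq_abs _ ▸ (fderiv ℝ σ x).le_opNorm (b i)).trans
                      (by rw [b.orthonormal.1 i, mul_one]; exact hCd x)
                  · exact abs_real_inner_le_norm _ _
              _ ≤ Cd * R := by
                  rw [b.orthonormal.1 i, one_mul]
                  gcongr
                  exact (norm_nonneg _).trans (hCd x)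
    · have hxσ : x ∉ tsupport σ := fun h => hx (hR h)
      simp [indicator_of_notMem hx, image_eq_zero_of_notMem_tsupport hxσ,
        fderiv_of_notMem_tsupport (𝕜 := ℝ) hxσ]
  have hIR : ∀ i, Integrable (fun x => (σ x * ⟪b i, x⟫) * (2 * ⟪V x, G x (b i)⟫)) volume := by
    intro i
    refine (hVGI.const_mul (Cσ * R * 2)).mono'
      ((hσ.contDiff.continuous.mul (hlin i).continuous).aestronglyMeasurable.mul
        ((hVm.inner ((ContinuousLinearMap.apply ℝ E (b i)).continuous.comp_aestronglyMeasurable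
          hGm0)).const_mul 2))
      (Eventually.of_forall fun x => ?_)
    by_cases hx : x ∈ (Ω : Set E)
    · have hxR : ‖x‖ ≤ R := (mem_ball_zero_iff.1 hx).le
      have hCσ0 : 0 ≤ Cσ := (norm_nonneg _).trans (hCσ 0)
      simp only [Pi.mul_apply, indicator_of_mem hx, norm_mul, Real.norm_eq_abs, abs_two]
      calc |σ x| * |⟪b i, x⟫| * (2 * |⟪V x, G x (b i)⟫|)
          ≤ Cσ * (‖b i‖ * ‖x‖) * (2 * (‖V x‖ * (‖G x‖ * ‖b i‖))) := by
            gcongr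
            · simpa [Real.norm_eq_abs] using hCσ x
            · exact abs_real_inner_le_norm _ _
            · exact (abs_real_inner_le_norm _ _).trans (by gcongr; exact (G x).le_opNorm (b i))
        _ ≤ Cσ * R * 2 * (‖V x‖ * ‖G x‖) := by
            rw [b.orthonormal.1 i, one_mul, mul_one]
            have : Cσ * ‖x‖ ≤ Cσ * R := by gcongr
            nlinarith [norm_nonneg (V x), norm_nonneg (G x), mul_nonneg (norm_nonneg (V x)) (norm_nonneg (G x))]
    · have hxσ : x ∉ tsupport σ := fun h => hx (hR h)
      simp [indicator_of_notMem hx, image_eq_zero_of_notMem_tsupport hxσ]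
  -- sum over the basis
  have hsum := Finset.sum_congr rfl fun i (_ : i ∈ Finset.univ) => hid i
  rw [← integral_finsetSum _ fun i _ => hIL i, Finset.sum_neg_distrib,
    ← integral_finsetSum _ fun i _ => hIR i] at hsum
  -- identify the summed integrands
  have eL : ∀ x, ∑ i, (fderiv ℝ σ x (b i) * ⟪b i, x⟫ + σ x) * ‖V x‖ ^ 2 =
      ‖V x‖ ^ 2 * ((Module.finrank ℝ E : ℝ) * σ x + ⟪x, gradient σ x⟫) := by
    intro x
    rw [← Finset.sum_mul, Finset.sum_add_distrib, Finset.sum_const, Finset.card_univ,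
      Fintype.card_fin, nsmul_eq_mul, inner_gradient_eq_sum σ x x]
    have : ∑ i, fderiv ℝ σ x (b i) * ⟪b i, x⟫ = ∑ i, ⟪b i, x⟫ * fderiv ℝ σ x (b i) :=
      Finset.sum_congr rfl fun i _ => mul_comm _ _
    rw [this]
    ring
  have eR : ∀ x, ∑ i, (σ x * ⟪b i, x⟫) * (2 * ⟪V x, G x (b i)⟫) = 2 * (σ x * ⟪G x x, V x⟫) := by
    intro x
    rw [real_inner_comm (V x) (G x x), clm_apply_eq_sum_inner_smul_stdBasis (G x) x, inner_sum]
    rw [Finset.mul_sum, Finset.mul_sum]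
    refine Finset.sum_congr rfl fun i _ => ?_
    rw [inner_smul_right]
    ring
  simp_rw [eL, eR] at hsum
  rw [integral_const_mul] at hsum
  linarith

/-- **The local energy identity of a self-similar Euler profile in the weak class** (Chae–Shvydkoy
2013, (2.1) and §2.2: the profile equation `b y·∇v + a v + (v·∇)v + ∇q = 0`-type balance and its
local energy equality, there derived for `C¹_loc` profiles).  Let `V ∈ L⁴_loc` be weakly
divergence free with weak gradient `G ∈ L²_loc`, `P ∈ L^{3/2}_loc`, and suppose the profile
equation `(V·∇)V + ∇P = a V + b (x·∇)V` holds weakly: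
`∫ (⟪a V + b G(x) x, ψ⟫ + ⟪V, Dψ(V)⟫ + P div ψ) = 0` for all `ψ ∈ C_c^∞`.  Then for every real
test function `σ`,
`a ∫ σ‖V‖² − (b/2) ∫ ‖V‖² (dim E · σ + ⟪x, ∇σ⟫) + ∫ (‖V‖²/2 + P) ⟪V, ∇σ⟫ = 0`.
[cite: ChaeShvydkoy2013, (2.1) and §2.2 (2.9)] -/
theorem selfSimilarProfile_localEnergyIdentity (a b : ℝ)
    (hV4 : ∀ r : ℝ, MemLp V 4 (volume.restrict (ball (0 : E) r)))
    (hG : HasWeakGradient V G)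
    (hG2 : ∀ (r : ℝ) (v : E), MemLp (fun x => G x v) 2 (volume.restrict (ball (0 : E) r)))
    (hdiv : IsWeaklyDivFree V)
    (hP : ∀ r : ℝ, MemLp P (3 / 2) (volume.restrict (ball (0 : E) r)))
    (hEq : ∀ ψ : E → E, IsTestFunctionOn (⊤ : Opens E) ψ →
      ∫ x, (⟪a • V x + b • G x x, ψ x⟫ + ⟪V x, fderiv ℝ ψ x (V x)⟫ +
        P x * VectorCalculus.divergence ψ x) = 0)
    {σ : E → ℝ} (hσ : IsTestFunctionOn (⊤ : Opens E) σ) :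
    a * (∫ x, σ x * ‖V x‖ ^ 2) -
        b / 2 * (∫ x, ‖V x‖ ^ 2 * ((Module.finrank ℝ E : ℝ) * σ x + ⟪x, gradient σ x⟫)) +
      ∫ x, (‖V x‖ ^ 2 / 2 + P x) * ⟪V x, gradient σ x⟫ = 0 := by
  have hVm : AEStronglyMeasurable V volume := by
    have := hG.locallyIntegrableOn.aestronglyMeasurable
    simpa only [Opens.coe_top, Measure.restrict_univ] using this
  have hGm0 : AEStronglyMeasurable G volume := by
    have := hG.locallyIntegrableOn_deriv.aestronglyMeasurable
    simpa only [Opens.coe_top, Measure.restrict_univ] using this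
  have hV2 : ∀ r : ℝ, MemLp V 2 (volume.restrict (ball (0 : E) r)) := fun r => by
    haveI : IsFiniteMeasure (volume.restrict (ball (0 : E) r)) :=
      isFiniteMeasure_restrict.2 measure_ball_lt_top.ne
    exact (hV4 r).mono_exponent (by norm_num)
  -- the forcing `F = a V + b (x·∇)V` is in `L²_loc`
  set F : E → E := fun x => a • V x + b • G x x with hF_def
  have hF : ∀ r : ℝ, MemLp F 2 (volume.restrict (ball (0 : E) r)) := by
    intro r
    have hGr : MemLp G 2 (volume.restrict (ball (0 : E) r)) :=
      memLp_two_of_forall_apply (Ω := ⟨ball (0 : E) r, isOpen_ball⟩) hGm0.restrict (hG2 r)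
    have hGx : MemLp (fun x => G x x) 2 (volume.restrict (ball (0 : E) r)) := by
      refine MemLp.of_le_mul (c := |r|) hGr (aestronglyMeasurable_clm_apply_field hGm0.restrict
        aestronglyMeasurable_id.restrict) ?_
      filter_upwards [ae_restrict_mem measurableSet_ball] with x hx
      calc ‖G x x‖ ≤ ‖G x‖ * ‖x‖ := (G x).le_opNorm x
        _ ≤ ‖G x‖ * |r| := by gcongr; exact (mem_ball_zero_iff.1 hx).le.trans (le_abs_self r)
        _ = |r| * ‖G x‖ := mul_comm _ _
    exact ((hV2 r).const_smul a).add (hGx.const_smul b)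
  have hmain := steadyEuler_localEnergyIdentity hV4 hG hG2 hdiv hP hF hEq hσ
  -- the linear term
  obtain ⟨R, -, hR⟩ := hσ.hasCompactSupport.isCompact.isBounded.subset_ball_lt 0 0
  obtain ⟨Cσ, hCσ⟩ := hσ.contDiff.continuous.bounded_above_of_compact_support hσ.hasCompactSupport
  haveI : IsFiniteMeasure (volume.restrict (ball (0 : E) R)) :=
    isFiniteMeasure_restrict.2 measure_ball_lt_top.ne
  have hA2 : Integrable ((ball (0 : E) R).indicator fun x => ‖V x‖ ^ 2) volume :=
    memLp_one_iff_integrable.1 ((memLp_indicator_iff_restrict measurableSet_ball).2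
      (memLp_one_iff_integrable.2 ((memLp_two_iff_integrable_sq_norm (hV2 R).1).1 (hV2 R))))
  have hI1 : Integrable (fun x => σ x * ‖V x‖ ^ 2) volume := by
    refine (hA2.const_mul Cσ).mono' (hσ.contDiff.continuous.aestronglyMeasurable.mul (hVm.norm.pow 2))
      (Eventually.of_forall fun x => ?_)
    by_cases hx : x ∈ ball (0 : E) R
    · simp only [indicator_of_mem hx, norm_mul, Real.norm_eq_abs, abs_pow, abs_norm]
      gcongr; simpa [Real.norm_eq_abs] using hCσ x
    · have hxσ : x ∉ tsupport σ := fun h => hx (hR h)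
      simp [indicator_of_notMem hx, image_eq_zero_of_notMem_tsupport hxσ]
  have hI2 : Integrable (fun x => σ x * ⟪G x x, V x⟫) volume := by
    have hGR : MemLp G 2 (volume.restrict (ball (0 : E) R)) :=
      memLp_two_of_forall_apply (Ω := ⟨ball (0 : E) R, isOpen_ball⟩) hGm0.restrict (hG2 R)
    have hA : MemLp ((ball (0 : E) R).indicator fun x => ‖V x‖) 2 volume :=
      (memLp_indicator_iff_restrict measurableSet_ball).2 (hV2 R).norm
    have hB : MemLp ((ball (0 : E) R).indicator fun x => ‖G x‖) 2 volume :=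
      (memLp_indicator_iff_restrict measurableSet_ball).2 hGR.norm
    have hCσ0 : 0 ≤ Cσ := (norm_nonneg _).trans (hCσ 0)
    refine ((MemLp.integrable_mul hB hA).const_mul (Cσ * R)).mono'
      (hσ.contDiff.continuous.aestronglyMeasurable.mul
        ((aestronglyMeasurable_clm_apply_field hGm0 aestronglyMeasurable_id).inner hVm))
      (Eventually.of_forall fun x => ?_)
    by_cases hx : x ∈ ball (0 : E) R
    · have hxR : ‖x‖ ≤ R := (mem_ball_zero_iff.1 hx).le
      simp only [Pi.mul_apply, indicator_of_mem hx, norm_mul, Real.norm_eq_abs]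
      calc |σ x| * |⟪G x x, V x⟫| ≤ Cσ * (‖G x‖ * ‖x‖ * ‖V x‖) := by
            gcongr
            · simpa [Real.norm_eq_abs] using hCσ x
            · exact (abs_real_inner_le_norm _ _).trans (by gcongr; exact (G x).le_opNorm x)
        _ ≤ Cσ * R * (‖G x‖ * ‖V x‖) := by
            have : Cσ * ‖x‖ ≤ Cσ * R := by gcongr
            nlinarith [norm_nonneg (V x), norm_nonneg (G x),
              mul_nonneg (norm_nonneg (G x)) (norm_nonneg (V x))]
    · have hxσ : x ∉ tsupport σ := fun h => hx (hR h)
      simp [indicator_of_notMem hx, image_eq_zero_of_notMem_tsupport hxσ]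
  have e1 : (∫ x, σ x * ⟪F x, V x⟫) = a * (∫ x, σ x * ‖V x‖ ^ 2) + b * ∫ x, σ x * ⟪G x x, V x⟫ := by
    rw [← integral_const_mul, ← integral_const_mul, ← integral_add (hI1.const_mul a) (hI2.const_mul b)]
    refine integral_congr_ae (Eventually.of_forall fun x => ?_)
    simp only [hF_def, inner_add_left, inner_smul_left, real_inner_self_eq_norm_sq, RCLike.conj_to_real]
    ring
  rw [e1, integral_mul_inner_weakGradient_apply_id hV2 hG hG2 hσ] at hmain
  linarith

end SelfSimilar

/-! ### Dimension three: `H¹_loc ⊂ L⁶_loc ⊂ L⁴_loc` -/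

section Sobolev

variable {V : E → E} {G : E → E →L[ℝ] E}

/-- **Sobolev on balls in dimension three**: if `dim E = 3`, `V ∈ L²(B(0,R))` and `V` has a
whole-space weak gradient `G` with `G ∈ L²(B(0,R))` componentwise, then `V ∈ L⁶(B(0,R))`
(the tree's embedding `W^{1,2}(Ω) ⊂ L⁶(Ω)` on the bounded Lipschitz domain `Ω = B(0,R)`,
`exists_eLpNorm_le_of_memSobolevDomain_one`; Evans, *PDE*, §5.6.3 Thm. 6). [cite: Evans2010, §5.6.3 Thm. 6] -/
theorem memLp_six_ball_of_hasWeakGradient (hE : Module.finrank ℝ E = 3) (hG : HasWeakGradient V G)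
    {R : ℝ} (hV2 : MemLp V 2 (volume.restrict (ball (0 : E) R)))
    (hG2 : ∀ v : E, MemLp (fun x => G x v) 2 (volume.restrict (ball (0 : E) R))) :
    MemLp V 6 (volume.restrict (ball (0 : E) R)) := by
  set B : Opens E := ⟨ball (0 : E) R, isOpen_ball⟩ with hB
  have hGB : HasWeakFDerivOn B volume V G := HasWeakFDerivOn.mono_set_holds hG le_top
  have hW : MemSobolevDomain 1 ((2 : ℝ≥0) : ℝ≥0∞) B volume V := by
    refine (memSobolevDomain_succ_iff (k := 0)).2 ⟨by exact_mod_cast hV2, G, hGB, fun v => ?_⟩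
    rw [memSobolevDomain_zero_iff]
    exact_mod_cast hG2 v
  have hn : ((2 : ℝ≥0) : ℝ) < Module.finrank ℝ E := by rw [hE]; norm_num
  have hp' : (((6 : ℝ≥0) : ℝ))⁻¹ = ((2 : ℝ≥0) : ℝ)⁻¹ - (Module.finrank ℝ E : ℝ)⁻¹ := by
    rw [hE]; push_cast; norm_num
  obtain ⟨C, hC⟩ := exists_eLpNorm_le_of_memSobolevDomain_one (F := E) (isLipschitzDomain_ball (0 : E) R)
    isBounded_ball (p := 2) (p' := 6) one_le_two hn hp' volume
  have hGm : AEStronglyMeasurable G (volume.restrict (ball (0 : E) R)) :=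
    hGB.locallyIntegrableOn_deriv.aestronglyMeasurable
  have hGL2 : MemLp G 2 (volume.restrict (ball (0 : E) R)) :=
    memLp_two_of_forall_apply (Ω := B) hGm hG2
  have h := hC V G hW hGB
  refine ⟨hV2.1, ?_⟩
  have e6 : ((6 : ℝ≥0) : ℝ≥0∞) = (6 : ℝ≥0∞) := rfl
  have e2 : ((2 : ℝ≥0) : ℝ≥0∞) = 2 := rfl
  rw [e6, e2] at h
  refine lt_of_le_of_lt h (ENNReal.mul_lt_top ENNReal.coe_lt_top ?_)
  exact ENNReal.add_lt_top.2 ⟨hV2.2, hGL2.2⟩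

/-- In dimension three, `V ∈ L²_loc` with weak gradient `G ∈ L²_loc` gives `V ∈ L⁴` on every ball
(from `memLp_six_ball_of_hasWeakGradient` and `L⁶ ⊂ L⁴` on sets of finite measure) — the
hypothesis `hV4` of the energy identities above (Evans, *PDE*, §5.6.3 Thm. 6). [cite: Evans2010, §5.6.3 Thm. 6] -/
theorem memLp_four_ball_of_hasWeakGradient (hE : Module.finrank ℝ E = 3) (hG : HasWeakGradient V G)
    (hV2 : ∀ r : ℝ, MemLp V 2 (volume.restrict (ball (0 : E) r)))
    (hG2 : ∀ (r : ℝ) (v : E), MemLp (fun x => G x v) 2 (volume.restrict (ball (0 : E) r))) (r : ℝ) :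
    MemLp V 4 (volume.restrict (ball (0 : E) r)) := by
  haveI : IsFiniteMeasure (volume.restrict (ball (0 : E) r)) :=
    isFiniteMeasure_restrict.2 measure_ball_lt_top.ne
  exact (memLp_six_ball_of_hasWeakGradient hE hG (hV2 r) (hG2 r)).mono_exponent (by norm_num)

end Sobolev


/-! ### The profile identity in the normalisation of the tree's collapse ansatz -/

section CollapseAnsatz

variable {V : E → E} {P : E → ℝ} {G : E → E →L[ℝ] E}

/-- **Local energy equality of a self-similar Euler profile, in the normalisation of the tree's
ansatz `selfSimilarCollapse γ T U`** (`u(t,x) = (T−t)^{γ−1} U((T−t)^{−γ}x)`, Constantin–Ignatova–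
Vicol (3.2)–(3.3); the tree's `ns_momentum_selfSimilarCollapse`: the Euler operator of the ansatz
is `(T−t)^{γ−2} • [(1−γ)U + DU(γy + U) + ∇P]`, so the profile equation reads
`(U·∇)U + ∇P = (γ−1) U − γ (y·∇)U`).  If this profile equation holds weakly for a weakly
divergence-free `V ∈ L⁴_loc` with weak gradient `G ∈ L²_loc` and `P ∈ L^{3/2}_loc`, then for
every real test function `σ`, with `n = dim E`,
`(2 − (n+2)γ) ∫ σ‖V‖² = ∫ (‖V‖² + 2P) ⟪V, ∇σ⟫ + γ ∫ ‖V‖² ⟪x, ∇σ⟫`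
— for `n = 3` the factor is `2 − 5γ`; with `γ = 1/(1+α)` this is Chae–Shvydkoy's local energy
equality (2.9) differentiated in the scale, now for `H¹_loc` profiles instead of `C¹_loc`.
[cite: ChaeShvydkoy2013, (2.1) and §2.2 (2.9); ConstantinIgnatovaVicol2026Putative §3.1 (3.2)–(3.3)] -/
theorem selfSimilarCollapseProfile_localEnergyIdentity (γ : ℝ)
    (hV4 : ∀ r : ℝ, MemLp V 4 (volume.restrict (ball (0 : E) r)))
    (hG : HasWeakGradient V G)
    (hG2 : ∀ (r : ℝ) (v : E), MemLp (fun x => G x v) 2 (volume.restrict (ball (0 : E) r)))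
    (hdiv : IsWeaklyDivFree V)
    (hP : ∀ r : ℝ, MemLp P (3 / 2) (volume.restrict (ball (0 : E) r)))
    (hEq : ∀ ψ : E → E, IsTestFunctionOn (⊤ : Opens E) ψ →
      ∫ x, (⟪(γ - 1) • V x + (-γ) • G x x, ψ x⟫ + ⟪V x, fderiv ℝ ψ x (V x)⟫ +
        P x * VectorCalculus.divergence ψ x) = 0)
    {σ : E → ℝ} (hσ : IsTestFunctionOn (⊤ : Opens E) σ) :
    (2 - ((Module.finrank ℝ E : ℝ) + 2) * γ) * (∫ x, σ x * ‖V x‖ ^ 2) =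
      (∫ x, (‖V x‖ ^ 2 + 2 * P x) * ⟪V x, gradient σ x⟫) +
        γ * ∫ x, ‖V x‖ ^ 2 * ⟪x, gradient σ x⟫ := by
  have hmain := selfSimilarProfile_localEnergyIdentity (γ - 1) (-γ) hV4 hG hG2 hdiv hP hEq hσ
  -- split the integrals appearing in `hmain` and in the goal
  obtain ⟨R, -, hR⟩ := hσ.hasCompactSupport.isCompact.isBounded.subset_ball_lt 0 0
  haveI : IsFiniteMeasure (volume.restrict (ball (0 : E) R)) :=
    isFiniteMeasure_restrict.2 measure_ball_lt_top.ne
  have hVm : AEStronglyMeasurable V volume := by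
    have := hG.locallyIntegrableOn.aestronglyMeasurable
    simpa only [Opens.coe_top, Measure.restrict_univ] using this
  have hPm : AEStronglyMeasurable P volume :=
    aestronglyMeasurable_of_forall_ball fun n => (hP n).1
  have hV3R : MemLp V 3 (volume.restrict (ball (0 : E) R)) := (hV4 R).mono_exponent (by norm_num)
  have hV2R : MemLp V 2 (volume.restrict (ball (0 : E) R)) := (hV4 R).mono_exponent (by norm_num)
  have hI1 := integrable_norm_sq_mul_inner_gradient hσ hR hVm (hV4 R)
  have hI3 := integrable_pressure_mul_inner_gradient hσ hR hVm hPm hV3R (hP R)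
  -- `∫ ‖V‖² (n σ + ⟪x,∇σ⟫) = n ∫ σ‖V‖² + ∫ ‖V‖²⟪x,∇σ⟫`
  obtain ⟨Cσ, hCσ⟩ := hσ.contDiff.continuous.bounded_above_of_compact_support hσ.hasCompactSupport
  obtain ⟨Cd, hCd⟩ := (hσ.contDiff.continuous_fderiv (by simp)).bounded_above_of_compact_support
    (hσ.hasCompactSupport.fderiv ℝ)
  have hA2 : Integrable ((ball (0 : E) R).indicator fun x => ‖V x‖ ^ 2) volume :=
    memLp_one_iff_integrable.1 ((memLp_indicator_iff_restrict measurableSet_ball).2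
      (memLp_one_iff_integrable.2 ((memLp_two_iff_integrable_sq_norm hV2R.1).1 hV2R)))
  have hJ1 : Integrable (fun x => σ x * ‖V x‖ ^ 2) volume := by
    refine (hA2.const_mul Cσ).mono' (hσ.contDiff.continuous.aestronglyMeasurable.mul (hVm.norm.pow 2))
      (Eventually.of_forall fun x => ?_)
    by_cases hx : x ∈ ball (0 : E) R
    · simp only [indicator_of_mem hx, norm_mul, Real.norm_eq_abs, abs_pow, abs_norm]
      gcongr; simpa [Real.norm_eq_abs] using hCσ x
    · have hxσ : x ∉ tsupport σ := fun h => hx (hR h)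
      simp [indicator_of_notMem hx, image_eq_zero_of_notMem_tsupport hxσ]
  have hgradc : Continuous (gradient σ) :=
    (InnerProductSpace.toDual ℝ E).symm.continuous.comp (hσ.contDiff.continuous_fderiv (by simp))
  have hJ2 : Integrable (fun x => ‖V x‖ ^ 2 * ⟪x, gradient σ x⟫) volume := by
    refine (hA2.const_mul (R * Cd)).mono' ((hVm.norm.pow 2).mul
      (continuous_id.inner hgradc).aestronglyMeasurable) (Eventually.of_forall fun x => ?_)
    by_cases hx : x ∈ ball (0 : E) R
    · have hxR : ‖x‖ ≤ R := (mem_ball_zero_iff.1 hx).le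
      simp only [indicator_of_mem hx, norm_mul, Real.norm_eq_abs, abs_pow, abs_norm]
      rw [mul_comm (R * Cd)]
      gcongr
      rw [real_inner_comm, inner_gradient_left]
      calc |fderiv ℝ σ x x| ≤ ‖fderiv ℝ σ x‖ * ‖x‖ := Real.norm_eq_abs _ ▸ (fderiv ℝ σ x).le_opNorm x
        _ ≤ Cd * R := by gcongr; exacts [(norm_nonneg _).trans (hCd x), hCd x]
        _ = R * Cd := mul_comm _ _
    · have hxσ : x ∉ tsupport σ := fun h => hx (hR h)
      rw [real_inner_comm (gradient σ x) x, inner_gradient_left]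
      simp [indicator_of_notMem hx, fderiv_of_notMem_tsupport (𝕜 := ℝ) hxσ]
  have e1 : (∫ x, ‖V x‖ ^ 2 * ((Module.finrank ℝ E : ℝ) * σ x + ⟪x, gradient σ x⟫)) =
      (Module.finrank ℝ E : ℝ) * (∫ x, σ x * ‖V x‖ ^ 2) + ∫ x, ‖V x‖ ^ 2 * ⟪x, gradient σ x⟫ := by
    rw [← integral_const_mul, ← integral_add (hJ1.const_mul _) hJ2]
    refine integral_congr_ae (Eventually.of_forall fun x => ?_)
    ring
  have e2 : (∫ x, (‖V x‖ ^ 2 + 2 * P x) * ⟪V x, gradient σ x⟫) =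
      2 * ∫ x, (‖V x‖ ^ 2 / 2 + P x) * ⟪V x, gradient σ x⟫ := by
    rw [← integral_const_mul]
    refine integral_congr_ae (Eventually.of_forall fun x => ?_)
    ring
  rw [e1] at hmain
  rw [e2]
  linarith


/-- `selfSimilarCollapseProfile_localEnergyIdentity` in dimension `3` under `H¹_loc` hypotheses
only (`V ∈ L²_loc` with weak gradient `G ∈ L²_loc`; `V ∈ L⁴_loc` then follows from the Sobolev
embedding, `memLp_four_ball_of_hasWeakGradient`): `(2 − 5γ) ∫ σ‖V‖² = ∫ (‖V‖² + 2P)⟪V, ∇σ⟫ +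
γ ∫ ‖V‖²⟪x, ∇σ⟫`. The classical (`C²`-profile) identity in the `α`-normalisation
`γ = 1/(α+1)` is `IsSelfSimilarEulerProfile.localEnergy_identity`
(`SelfSimilarEulerL3Exclusion.lean`); this is its weak-profile form.
[cite: ChaeShvydkoy2013, §2.2 (2.9)–(2.11); ConstantinIgnatovaVicol2026Putative §3.1.1 (3.2)–(3.3)] -/
theorem selfSimilarCollapseProfile_localEnergyIdentity_three (hE : Module.finrank ℝ E = 3) (γ : ℝ)
    (hV2 : ∀ r : ℝ, MemLp V 2 (volume.restrict (ball (0 : E) r)))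
    (hG : HasWeakGradient V G)
    (hG2 : ∀ (r : ℝ) (v : E), MemLp (fun x => G x v) 2 (volume.restrict (ball (0 : E) r)))
    (hdiv : IsWeaklyDivFree V)
    (hP : ∀ r : ℝ, MemLp P (3 / 2) (volume.restrict (ball (0 : E) r)))
    (hEq : ∀ ψ : E → E, IsTestFunctionOn (⊤ : Opens E) ψ →
      ∫ x, (⟪(γ - 1) • V x + (-γ) • G x x, ψ x⟫ + ⟪V x, fderiv ℝ ψ x (V x)⟫ +
        P x * VectorCalculus.divergence ψ x) = 0)
    {σ : E → ℝ} (hσ : IsTestFunctionOn (⊤ : Opens E) σ) :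
    (2 - 5 * γ) * (∫ x, σ x * ‖V x‖ ^ 2) =
      (∫ x, (‖V x‖ ^ 2 + 2 * P x) * ⟪V x, gradient σ x⟫) +
        γ * ∫ x, ‖V x‖ ^ 2 * ⟪x, gradient σ x⟫ := by
  have h := selfSimilarCollapseProfile_localEnergyIdentity γ
    (memLp_four_ball_of_hasWeakGradient hE hG hV2 hG2) hG hG2 hdiv hP hEq hσ
  rw [hE] at h
  push_cast at h
  linear_combination h

/-- **The weak-profile local energy identity in Chae–Shvydkoy's `α`-normalisation**, in the
exact shape of the tree's classical `IsSelfSimilarEulerProfile.localEnergy_identity`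
(`γ = 1/(α+1)`; `n = dim E`): for every real test function `φ`,
`(2α − n) ∫ φ‖V‖² − ∫ (Dφ(y) y)‖V‖² = (1 + α) ∫ (‖V‖² + 2P)(Dφ(y) V(y))`,
now for a weakly divergence-free `V ∈ L⁴_loc` with weak gradient in `L²_loc` and `P ∈ L^{3/2}_loc`
solving the profile equation `(1−γ)V + DV(γy + V) + ∇P = 0` weakly (instead of `V ∈ C²`,
`P ∈ C¹`). [cite: ChaeShvydkoy2013, §2.2 (2.9)–(2.11); ConstantinIgnatovaVicol2026Putative §3.1.1 (3.3)] -/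
theorem weakSelfSimilarEulerProfile_localEnergy_identity (α : ℝ) (hα : α + 1 ≠ 0)
    (hV4 : ∀ r : ℝ, MemLp V 4 (volume.restrict (ball (0 : E) r)))
    (hG : HasWeakGradient V G)
    (hG2 : ∀ (r : ℝ) (v : E), MemLp (fun x => G x v) 2 (volume.restrict (ball (0 : E) r)))
    (hdiv : IsWeaklyDivFree V)
    (hP : ∀ r : ℝ, MemLp P (3 / 2) (volume.restrict (ball (0 : E) r)))
    (hEq : ∀ ψ : E → E, IsTestFunctionOn (⊤ : Opens E) ψ →
      ∫ x, (⟪(1 / (α + 1) - 1) • V x + (-(1 / (α + 1))) • G x x, ψ x⟫ +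
        ⟪V x, fderiv ℝ ψ x (V x)⟫ + P x * VectorCalculus.divergence ψ x) = 0)
    {φ : E → ℝ} (hφ : IsTestFunctionOn (⊤ : Opens E) φ) :
    (2 * α - (Module.finrank ℝ E : ℝ)) * (∫ y, φ y * ‖V y‖ ^ 2) -
        ∫ y, fderiv ℝ φ y y * ‖V y‖ ^ 2 =
      (1 + α) * ∫ y, (‖V y‖ ^ 2 + 2 * P y) * fderiv ℝ φ y (V y) := by
  have h := selfSimilarCollapseProfile_localEnergyIdentity (1 / (α + 1)) hV4 hG hG2 hdiv hP hEq hφ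
  have hγ : (1 / (α + 1)) * (α + 1) = 1 := by field_simp
  have hig : ∀ v y : E, ⟪v, gradient φ y⟫ = fderiv ℝ φ y v := fun v y => by
    rw [real_inner_comm, inner_gradient_left]
  have e3 : (∫ y, (‖V y‖ ^ 2 + 2 * P y) * ⟪V y, gradient φ y⟫) =
      ∫ y, (‖V y‖ ^ 2 + 2 * P y) * fderiv ℝ φ y (V y) :=
    integral_congr_ae (Eventually.of_forall fun y => by simp only [hig])
  have e4 : (∫ y, ‖V y‖ ^ 2 * ⟪y, gradient φ y⟫) = ∫ y, fderiv ℝ φ y y * ‖V y‖ ^ 2 :=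
    integral_congr_ae (Eventually.of_forall fun y => by simp only [hig]; ring)
  rw [e3, e4] at h
  linear_combination (α + 1) * h +
    (((Module.finrank ℝ E : ℝ) + 2) * (∫ y, φ y * ‖V y‖ ^ 2) + ∫ y, fderiv ℝ φ y y * ‖V y‖ ^ 2) * hγ

/-- `weakSelfSimilarEulerProfile_localEnergy_identity` in dimension `3` under `H¹_loc`
hypotheses only (the literal shape of `IsSelfSimilarEulerProfile.localEnergy_identity`):
`(2α − 3) ∫ φ‖V‖² − ∫ (Dφ(y) y)‖V‖² = (1 + α) ∫ (‖V‖² + 2P)(Dφ(y) V(y))`.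
[cite: ChaeShvydkoy2013, §2.2 (2.9)–(2.11); ConstantinIgnatovaVicol2026Putative §3.1.1 (3.3)] -/
theorem weakSelfSimilarEulerProfile_localEnergy_identity_three (hE : Module.finrank ℝ E = 3)
    (α : ℝ) (hα : α + 1 ≠ 0)
    (hV2 : ∀ r : ℝ, MemLp V 2 (volume.restrict (ball (0 : E) r)))
    (hG : HasWeakGradient V G)
    (hG2 : ∀ (r : ℝ) (v : E), MemLp (fun x => G x v) 2 (volume.restrict (ball (0 : E) r)))
    (hdiv : IsWeaklyDivFree V)
    (hP : ∀ r : ℝ, MemLp P (3 / 2) (volume.restrict (ball (0 : E) r)))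
    (hEq : ∀ ψ : E → E, IsTestFunctionOn (⊤ : Opens E) ψ →
      ∫ x, (⟪(1 / (α + 1) - 1) • V x + (-(1 / (α + 1))) • G x x, ψ x⟫ +
        ⟪V x, fderiv ℝ ψ x (V x)⟫ + P x * VectorCalculus.divergence ψ x) = 0)
    {φ : E → ℝ} (hφ : IsTestFunctionOn (⊤ : Opens E) φ) :
    (2 * α - 3) * (∫ y, φ y * ‖V y‖ ^ 2) - ∫ y, fderiv ℝ φ y y * ‖V y‖ ^ 2 =
      (1 + α) * ∫ y, (‖V y‖ ^ 2 + 2 * P y) * fderiv ℝ φ y (V y) := by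
  have h := weakSelfSimilarEulerProfile_localEnergy_identity α hα
    (memLp_four_ball_of_hasWeakGradient hE hG hV2 hG2) hG hG2 hdiv hP hEq hφ
  rw [hE] at h
  push_cast at h
  linear_combination h

end CollapseAnsatz

end Literature.Analysis.FluidPDE

end
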